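import Literature.MathematicalPhysics.QuantumFieldTheory.Balaban1983to89.B4Ineq110WalkRoute
import Mathlib.LinearAlgebra.Matrix.Action

/-!
# `Balaban1983to89.B4Ineq110LpChain` — [Balaban1983RegularityDecay] THEOREM (1.10), value member, FOR A GENERAL REGION
# `Ω` UNDER THE PRINTED RESTRICTION `dist(x, Ω^c) ≥ R₀`, BY THE PRINTED MIXED `L^p` CHAIN (2.18)–(2.22) on the concrete
# operators: interior cubes carry Lemma 2.2's sup bound and graded `‖·‖_{p₁/(i−1),p₁/i}` bounds, ALL cubes only
# Lemma 2.1's `L²` bound; the convergence of (2.18) «one of the consequences of our estimates»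

statement-level skeleton of published theorems with citation tags; proofs where landed; nothing here is a claim about the Yang–Mills mass gap

CITATION HEADER.  T. Bałaban, *Regularity and decay of lattice Green's functions*, Commun. Math. Phys. **89** (1983)
571–597, doi:10.1007/bf01214744 [Balaban1983RegularityDecay] (cell paper B4; held text
`paper:balaban1983-cmp89-regularity-decay`, journal page = PDF page + 570; pp. 573, 575–579).  Unit `lit-balaban-r01`
gen 6 (B4 fold owner), HOME `run/shared/lean/pub/lit-balaban/`, SKELETON rows **B4.Thm@573** ((1.10) value member,
general `Ω`, `R₀`), **B4.Eq2.18** ((2.18)–(2.22): the chain ON THE CONCRETE OPERATORS), **B4.Eq2.12** ((2.12) in the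
printed sense: convergence from the estimates).  Imports `B4Ineq110WalkRoute` (→ `B4Eq212SmallR`, `B4Eq213ConcreteWalk`,
`B4LpChain221`) and Mathlib's `Matrix.Action` (the module structure `A • v = A *ᵥ v` of square matrices on vectors).

WHAT IS PRINTED (verbatim, pp. 578–579).  *«We do not know yet if the series on the right side of (2.18) is convergent,
and it will be one of the consequences of our estimates. Let us now take a positive integer n₀, we will fix it later,
and let us define R₀ as R₀ = (diameter of ⋃_{ω=(ω₀,…,ω_{n₀}), ω₀=0} ⋃_{i=1}^{n₀} □̂_{ω_i}) + 2M. (2.19) Here □̂_j denotes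
a cube with center Mj and size equal to 2M. … We divide the sum in (2.18) into two subsums: one with n ≤ n₀ and the
other with n > n₀. The first is finite and the condition dist({x,x′},Ω^c) ≥ R₀, together with the definition (2.19)
of R₀ imply that all □_{ω_i} are cubes contained in Ω. The same of course holds for the first n₀ elements of the
sequences ω in the second sum. We estimate the first sum using Lemma 2.2 by
Σ_{ω:n≤n₀} c₁ Π_{i=1}^{n} ‖K_{ω_i}G_k(□_{ω_i},Ã_{ω_i})h_{ω_i}‖_∞ ‖f‖_∞ (2.20)  We apply Lemma 2.2 to the terms of the
second sum also, more exactly we apply (2.17) with 1/p − 1/q = 1/p₁ and we fix n₀ such that p₁ = 2n₀ > d + 1, e.g.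
n₀ = d. We estimate the second sum by Σ_{ω:n>n₀} c₁‖K_{ω₁}G_k(□_{ω₁},Ã_{ω₁})h_{ω₁}‖_{∞,p₁}‖K_{ω₂}…h_{ω₂}‖_{p₁,p₁/2} ⋯
‖K_{ω_{n₀}}…h_{ω_{n₀}}‖_{p₁/(n₀−1),2} Π_{i=n₀+1}^{n} ‖K_{ω_i}G_k(□_{ω_i},Ã_{ω_i})h_{ω_i}‖_{2,2}‖f‖₂
≤ Σ_{ω:n>n₀} c₁(c₂O(1)M⁻¹)ⁿ‖f‖₂. (2.21)  Here ‖T‖_{q,p} denotes a norm of an operator T : L^p → L^q. Let us remark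
that the basic reason for the restriction dist({x,x′},Ω^c) ≥ R₀ is that we do not have the inequalities (2.16) for the
norms other than L₂-norms if □_j is not a cube (or rectangular parallelepiped). The summation in (2.18) is restricted
to paths ω satisfying x,x′ ∈ □_{ω₀}, supp f ⊂ □_{ω_n}, so the length n satisfies n ≥ M⁻¹dist({x,x′}, supp f) − 2.
There are at most 2^d(3^d)^{n−1}2^d of such paths, so finally we get the inequality (the left hand side of (1.9)) ≤
Σ 2^dc₁(3^dc₂O(1)M⁻¹)ⁿ‖f‖_∞ ≤ (2^{d+1}/e²)e^{−M⁻¹dist({x,x′},supp f)}‖f‖_∞ (2.22) where n ≥ M⁻¹dist({x,x′},supp f) − 2,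
and if M is fixed such that 3^dc₂O(1)M⁻¹ ≤ e⁻¹. Thus the inequality (1.9) is proved, similarly the inequalities
(1.10).»*  And pp. 574–575: *«it is sufficient to prove the Proposition for a function f with support in a unit cube Δ₀ = B^k(y₀), y₀ ∈ Ω^{(k)}; the general formulation is obtained by taking the decomposition f = Σ_{Δ⊂Ω} Δf and summing the inequalities.»*

WHAT THIS MODULE PROVES (all in full).
* §1 `lpv w p g = (w·Σ_z|g z|^p)^{1/p}` (the `η`-weighted `ℓ^p` functional, `w = η^d`), `lpv_nonneg`, `lpv_two_le`
  (`‖f‖₂ ≤ √(w·#S)‖f‖_∞` for `f` supported in `S` — the unit-cube reduction), `norm_le_lpv_two` (`‖g‖_∞ ≤ ‖g‖₂/√w`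
  on a finite lattice, used only qualitatively), and the printed chain of norms `lvl w n₀`: level `0` = `‖·‖_∞`,
  level `i` = `‖·‖_{p₁/i}`, `p₁ = 2n₀` (`lvl_zero`, `lvl_succ`, `lvl_top`: level `n₀` = `‖·‖₂`).
* §2 `neumann_partial`, **`lp_walk_bound_rem`**, `lp_walk_bound_rem_exp`, **`lattice_lp_walk_bound_rem`** — the abstract
  chain `B4LpChain221.lp_walk_bound`/`lattice_lp_walk_bound` ((2.18)–(2.22) over a ring acting on a module, graded
  seminorms as data) RE-ASSEMBLED WITHOUT AN OPERATOR TOPOLOGY: (2.12) enters as the identity `G = G₀ + G·R` (so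
  `G·f = Σ_{n<m}(G₀Rⁿ)·f + (GR^m)·f` exactly, `neumann_partial`) plus the decay of the remainder `Φ((GR^m)•f) → 0`,
  which is what the estimates give — the print's *«it will be one of the consequences of our estimates»*; same
  conclusion `Φ(G•f) ≤ 2|S₀|c₁Ve²e^{−r}‖f‖_∞`.
* §3 ON [B4]'s CONCRETE OPERATORS (setting of `B4Ineq110WalkRoute.ineq110_value`: sites `X`, `H = covOp c m² a q W T`
  (1.6) local at scale `M/8` with `G·H = 1`, labels `s`, Neumann-cut cube operators with inverses `G_j`, letters
  `a_j = h_jG_jh_j`, `b_j = K_jG_jh_j`, `R = Σ_j b_j`), vectors `E = X × κ → ℝ`: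
  `mulVec_letter_b_eq_zero_of_far` (row locality of `b_j`), `letter_b_mulVec_cut` (`b_j g = b_j(1_{supp h_j}g)`),
  **`lpv_two_R_mulVec_le`** (*«R is a small operator in reasonable norms»* in `L²`: `‖Rg‖₂ ≤ 2^dβ‖g‖₂` from
  `‖b_jg‖₂ ≤ β‖g‖₂` at EVERY cube — Lemma 2.1 — by the `2^d` row and column multiplicities), `lpv_two_R_pow_mulVec_le`,
  and **`ineq110_value_lp`**: HYPOTHESES = the per-cube inputs in EXACTLY the printed norms — a predicate `good` on
  labels (*«□_j are cubes contained in Ω»*) with, at good cubes, the cube-propagator sup bound `‖G_j‖ ≤ γ` ((2.16)/(2.17),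
  first letter), the sup factor bound `‖K_jG_jh_j‖ ≤ β` ((2.20)) and the graded bounds
  `‖K_jG_jh_jg‖_{(i−1)} ≤ β‖g‖_{(i)}`, `1 ≤ i ≤ n₀` ((2.21): Lemma 2.2 with `1/p − 1/q = 1/p₁`); at ALL cubes the `L²`
  bound `‖K_jG_jh_jg‖₂ ≤ β‖g‖₂` ((2.21): Lemma 2.1); `3^dβ ≤ e⁻¹`; and `R₀` IN LABEL FORM ((2.19)): every label within
  sup-distance `n₀` of a cube seeing `x` is good (the metric form being `B4LpChain221.reach_219`).  CONCLUSION: for `f`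
  supported in `F`, `‖f‖₂ ≤ V‖f‖_∞`, `D ≤ dist_∞(x,F)`:
  `‖1_x ⊙ (G_k(Ω,A)f)‖_∞ ≤ 2^{d+1}e^{9/4}·γ·V·e^{−D/M}·‖f‖_∞`; `ineq110_value_lp_apply` is the printed shape
  `|(G_k(Ω,A)f)(x)| ≤ c₀e^{−δ₀dist(x, supp f)}‖f‖_∞` (`c₀ = 2^{d+1}e^{9/4}γV`, `δ₀ = M⁻¹`).  The remainder decay is
  proved, not assumed: `Φ((GR^m)f) ≤ ‖G‖·(2^dβ)^m‖f‖₂/√w → 0`.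
* §4 (v1.1) **`probe_bound_lp`** — the same chain for an ARBITRARY LOCAL PROBE `P` (`P·h_j = 0` off a set `S₀` of
  `≤ m₀` cubes within `ρM` of `x₀`, first-letter input `‖P·h_jG_jh_j‖ ≤ α_P` on `S₀`, `R₀`: labels within `n₀` of `S₀`
  good): `‖P(G_k(Ω,A)f)‖_∞ ≤ 2m₀α_P·V·e^{ρ+13/8}·e^{−D/M}‖f‖_∞` — the derivative and Hölder members of (1.9)/(1.10) are
  its instances (`B4Ineq19LpChain`).
HONEST SCOPE.  Value member of (1.10) only (the derivative and Hölder members by this chain take the (2.17) members for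
`D^ηG_k` and (2.16) as the first-letter input — same assembly, not written here); the analytic inputs are HYPOTHESES in
the printed norms — at `A ≠ 0` they are Lemma 2.2 at `Ã_j` for the interior cubes (box carriers:
`B4Eq220CubeField.eq220_cubeField`/`eq221_cubeField`, p35) and Lemma 2.1 for all cubes (`B4Eq221L2FactorRegion`), to be
transported by the carrier bridge (`B4CubeOpReindex`, …, p17); `R₀` enters through its label-space consequence
(hypothesis `hR₀`); `V` is a parameter (`lpv_two_le` computes it; for unit-cube supports and `w = η^d`, `V = √N`); no
rectangular-`Ω` shortcut is used or needed.  No `def … : Prop`, no `sorry`; axioms standard.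
-/

namespace Literature.MathematicalPhysics.QuantumFieldTheory.Balaban1983to89.B4Ineq110LpChain

open Literature.MathematicalPhysics.QuantumFieldTheory.Balaban1983to89.B4GaugeCovariance
open Literature.MathematicalPhysics.QuantumFieldTheory.Balaban1983to89.B4Commutators25to211
open Literature.MathematicalPhysics.QuantumFieldTheory.Balaban1983to89.B4PartitionUnity22
open Literature.MathematicalPhysics.QuantumFieldTheory.Balaban1983to89.B4RandomWalk213
open Literature.MathematicalPhysics.QuantumFieldTheory.Balaban1983to89.B4LpChain221
open Literature.MathematicalPhysics.QuantumFieldTheory.Balaban1983to89.B4Eq213Locality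
open Literature.MathematicalPhysics.QuantumFieldTheory.Balaban1983to89.B4Eq26Locality
open Literature.MathematicalPhysics.QuantumFieldTheory.Balaban1983to89.B4Eq213ConcreteWalk
open Literature.MathematicalPhysics.QuantumFieldTheory.Balaban1983to89.B4Eq212SmallR
open Literature.MathematicalPhysics.QuantumFieldTheory.Balaban1983to89.B4Ineq110WalkRoute
open scoped Matrix NNReal
open scoped Matrix.Norms.Operator

/-! ## §1. The printed chain of norms on the vectors `m → ℝ` -/

section Norms

variable {m : Type*} [Fintype m]

/-- The weighted `ℓ^p` functional `‖g‖_p = (w·Σ_z |g z|^p)^{1/p}` — the print's `L^p` norms on the `η`-lattice for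
`w = η^d` (counting norms for `w = 1`). [cite: Balaban1983RegularityDecay, (2.17) p.578, (2.21) p.578] -/
noncomputable def lpv (w p : ℝ) (g : m → ℝ) : ℝ := (w * ∑ z, |g z| ^ p) ^ (1 / p)

/-- the weighted `ℓ^p` functional is non-negative. [cite: Balaban1983RegularityDecay, (2.17) p.578] -/
theorem lpv_nonneg {w : ℝ} (hw : 0 ≤ w) (p : ℝ) (g : m → ℝ) : 0 ≤ lpv w p g :=
  Real.rpow_nonneg (mul_nonneg hw (Finset.sum_nonneg fun _ _ => Real.rpow_nonneg (abs_nonneg _) _)) _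

/-- the `ℓ²` member as a square root of a sum of squares. [cite: Balaban1983RegularityDecay, (2.21) p.578] -/
theorem lpv_two_eq_sqrt (w : ℝ) (g : m → ℝ) : lpv w 2 g = Real.sqrt (w * ∑ z, g z ^ 2) := by
  unfold lpv
  rw [Real.sqrt_eq_rpow]
  congr 1
  congr 1
  exact Finset.sum_congr rfl fun z _ => by rw [Real.rpow_two, sq_abs]

/-- `‖f‖₂ ≤ √(w·#S)·‖f‖_∞` for `f` supported in `S` — the print's reduction *«it is sufficient to prove the Proposition
for a function f with support in a unit cube»* (there `‖f‖₂ ≤ ‖f‖_∞`: unit volume).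
[cite: Balaban1983RegularityDecay, §2 ¶1 pp.574–575, (2.21) p.578] -/
theorem lpv_two_le {w : ℝ} (hw : 0 ≤ w) (S : Finset m) (f : m → ℝ) (hf : ∀ z ∉ S, f z = 0) :
    lpv w 2 f ≤ Real.sqrt (w * S.card) * ‖f‖ := by
  classical
  have hsum : ∑ z, f z ^ 2 ≤ S.card * ‖f‖ ^ 2 := by
    have hzero : ∀ z ∈ Finset.univ, z ∉ S → f z ^ 2 = 0 := fun z _ hz => by rw [hf z hz]; ring
    rw [← Finset.sum_subset (Finset.subset_univ S) hzero]
    calc ∑ z ∈ S, f z ^ 2 ≤ ∑ _z ∈ S, ‖f‖ ^ 2 := Finset.sum_le_sum fun z _ => by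
            rw [← sq_abs]
            exact pow_le_pow_left₀ (abs_nonneg _) (by simpa [Real.norm_eq_abs] using norm_le_pi_norm f z) 2
      _ = S.card * ‖f‖ ^ 2 := by rw [Finset.sum_const, nsmul_eq_mul]
  have h0 : 0 ≤ w * ∑ z, f z ^ 2 := mul_nonneg hw (Finset.sum_nonneg fun z _ => sq_nonneg _)
  rw [lpv_two_eq_sqrt]
  calc Real.sqrt (w * ∑ z, f z ^ 2) ≤ Real.sqrt (w * (S.card * ‖f‖ ^ 2)) :=
        Real.sqrt_le_sqrt (mul_le_mul_of_nonneg_left hsum hw)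
    _ = Real.sqrt (w * S.card * ‖f‖ ^ 2) := by rw [mul_assoc]
    _ = Real.sqrt (w * S.card) * ‖f‖ := by
        rw [Real.sqrt_mul (mul_nonneg hw (Nat.cast_nonneg _)), Real.sqrt_sq (norm_nonneg _)]

/-- on a finite lattice `‖g‖_∞ ≤ ‖g‖₂/√w` (a single weighted square is at most the sum) — used only to see that the
remainder of the walk expansion tends to zero. [cite: Balaban1983RegularityDecay, (2.18) p.578] -/
theorem norm_le_lpv_two {w : ℝ} (hw : 0 < w) (g : m → ℝ) : ‖g‖ ≤ lpv w 2 g / Real.sqrt w := by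
  have hsw : 0 < Real.sqrt w := Real.sqrt_pos.mpr hw
  rw [lpv_two_eq_sqrt]
  refine (pi_norm_le_iff_of_nonneg (div_nonneg (Real.sqrt_nonneg _) hsw.le)).mpr fun z => ?_
  rw [Real.norm_eq_abs, le_div_iff₀ hsw, ← Real.sqrt_sq (abs_nonneg (g z)), ← Real.sqrt_mul (sq_nonneg |g z|)]
  refine Real.sqrt_le_sqrt ?_
  rw [sq_abs, mul_comm]
  exact mul_le_mul_of_nonneg_left
    (Finset.single_le_sum (f := fun y => g y ^ 2) (fun y _ => sq_nonneg (g y)) (Finset.mem_univ z)) hw.le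

/-- The chain of norms of (2.20)/(2.21): level `0` = `‖·‖_∞`, level `i` = `‖·‖_{p₁/i}` with `p₁ = 2n₀`
(`1 ≤ i ≤ n₀`), so that consecutive levels differ by `1/p − 1/q = 1/p₁` and level `n₀` is `‖·‖₂`.
[cite: Balaban1983RegularityDecay, (2.21) p.578] -/
noncomputable def lvl (w : ℝ) (n₀ i : ℕ) (g : m → ℝ) : ℝ := if i = 0 then ‖g‖ else lpv w (2 * n₀ / i) g

/-- level `0` of the chain is `‖·‖_∞` (the norm of (2.20)). [cite: Balaban1983RegularityDecay, (2.20) p.578] -/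
theorem lvl_zero (w : ℝ) (n₀ : ℕ) (g : m → ℝ) : lvl w n₀ 0 g = ‖g‖ := if_pos rfl

/-- level `i + 1` of the chain is `‖·‖_{p₁/(i+1)}`, `p₁ = 2n₀`. [cite: Balaban1983RegularityDecay, (2.21) p.578] -/
theorem lvl_succ (w : ℝ) (n₀ i : ℕ) (g : m → ℝ) : lvl w n₀ (i + 1) g = lpv w (2 * n₀ / (i + 1 : ℕ)) g :=
  if_neg (Nat.succ_ne_zero i)

/-- the top level `n₀` is the `ℓ²` norm (`p₁/n₀ = 2`). [cite: Balaban1983RegularityDecay, (2.21) p.578] -/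
theorem lvl_top (w : ℝ) {n₀ : ℕ} (hn₀ : 0 < n₀) (g : m → ℝ) : lvl w n₀ n₀ g = lpv w 2 g := by
  rw [lvl, if_neg hn₀.ne']
  congr 1
  rw [mul_div_assoc, div_self (Nat.cast_ne_zero.mpr hn₀.ne'), mul_one]

end Norms

/-! ## §2. (2.18)–(2.22) abstractly, with (2.12) in the printed sense (no operator topology) -/

section Abstract

variable {R : Type*} [Ring R] {E : Type*} [AddCommGroup E] [Module R E] {ι : Type*} [Fintype ι] [DecidableEq ι]

omit [Fintype ι] [DecidableEq ι] in
/-- (2.12) ITERATED ALGEBRAICALLY: from `G(1 − R) = G₀`, i.e. `G = G₀ + G·R`, for every `m`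
`G = Σ_{n<m} G₀Rⁿ + G·R^m`. [cite: Balaban1983RegularityDecay, (2.12) p.577] -/
theorem neumann_partial {G G₀ Rop : R} (hG : G = G₀ + G * Rop) (m : ℕ) :
    G = ∑ n ∈ Finset.range m, G₀ * Rop ^ n + G * Rop ^ m := by
  induction m with
  | zero => simp
  | succ m ih =>
      rw [Finset.sum_range_succ, add_assoc, pow_succ', ← mul_assoc, ← add_mul, ← hG]
      exact ih

/-- **(2.18)–(2.22), ABSTRACT FORM, CONVERGENCE FROM THE ESTIMATES.**  As `B4LpChain221.lp_walk_bound` (target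
functional `Φ` subadditive with `Φ 0 ≤ 0`, `≤ 0` after `a i` off `S₀` and `≤ c₁‖·‖_∞` after `a i` on `S₀`; `f` killed
off `S₁`, `‖f‖₂ ≤ V‖f‖_∞`; graded bounds of Lemma 2.2 at good labels, `L²` bound of Lemma 2.1 at all labels; walks
from `S₀` meet good labels at positions `≤ n₀`; out-degree `≤ D`, `Dβ < 1`; walks from `S₀` into `S₁` have `≥ N`
steps), but (2.12) is used as the IDENTITY `G = G₀ + G·R` together with the decay of the remainder `Φ((G·R^m)•f) → 0`
— *«We do not know yet if the series on the right side of (2.18) is convergent, and it will be one of the consequences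
of our estimates»* — instead of a `HasSum` in an operator topology.  Conclusion:
`Φ(G • f) ≤ |S₀|·c₁·V·(Dβ)^N/(1 − Dβ)·‖f‖_∞`. [cite: Balaban1983RegularityDecay, (2.12) p.577, (2.18)–(2.21) p.578, (2.22) p.579] -/
theorem lp_walk_bound_rem (adj : ι → ι → Prop) [DecidableRel adj]
    {a b : ι → R} {G G₀ Rop : R} {f : E} {Φ : E → ℝ} {nrm : ℕ → E → ℝ} {good : ι → Prop}
    {S₀ S₁ : Finset ι} {c₁ β : ℝ} {D N n₀ : ℕ}
    (hG₀ : G₀ = ∑ i, a i) (hRop : Rop = ∑ i, b i) (hG : G = G₀ + G * Rop)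
    (hrem : ∀ ε : ℝ, 0 < ε → ∃ m : ℕ, Φ ((G * Rop ^ m) • f) ≤ ε)
    (hab : ∀ i l, ¬ adj i l → a i * b l = 0) (hbb : ∀ i l, ¬ adj i l → b i * b l = 0)
    (hΦ0 : Φ 0 ≤ 0) (hΦadd : ∀ x y, Φ (x + y) ≤ Φ x + Φ y)
    (hS₀ : ∀ i ∉ S₀, ∀ g : E, Φ (a i • g) ≤ 0)
    (hS₁a : ∀ i ∉ S₁, a i • f = 0) (hS₁b : ∀ i ∉ S₁, b i • f = 0)
    (hc₁ : 0 ≤ c₁) (ha : ∀ i ∈ S₀, ∀ g : E, Φ (a i • g) ≤ c₁ * nrm 0 g)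
    (hβ : 0 ≤ β)
    (hgr : ∀ j, good j → ∀ i, 1 ≤ i → i ≤ n₀ → ∀ g : E, nrm (i - 1) (b j • g) ≤ β * nrm i g)
    (h2 : ∀ (j) (g : E), nrm n₀ (b j • g) ≤ β * nrm n₀ g)
    (h0 : ∀ j, good j → ∀ g : E, nrm 0 (b j • g) ≤ β * nrm 0 g)
    {V : ℝ} (hV : 1 ≤ V) (h2inf : nrm n₀ f ≤ V * nrm 0 f) (hnrm : 0 ≤ nrm 0 f)
    (hgood : ∀ (n : ℕ) (i : ι), i ∈ S₀ → ∀ ys : Fin n → ι, IsWalk adj i ys →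
      ∀ t : Fin n, (t : ℕ) + 1 ≤ n₀ → good (ys t))
    (hD : ∀ j, (Finset.univ.filter fun i => adj j i).card ≤ D) (hDβ : (D : ℝ) * β < 1)
    (hsep : ∀ (n : ℕ) (i : ι), i ∈ S₀ → ∀ ys : Fin n → ι, IsWalk adj i ys → lastPt i n ys ∈ S₁ → N ≤ n) :
    Φ (G • f) ≤ S₀.card * c₁ * V * ((D : ℝ) * β) ^ N / (1 - D * β) * nrm 0 f := by
  subst hG₀ hRop
  have hVn : 0 ≤ V * nrm 0 f := mul_nonneg (zero_le_one.trans hV) hnrm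
  set K : ℝ := S₀.card * c₁ * (V * nrm 0 f) with hK
  have hK0 : 0 ≤ K := mul_nonneg (mul_nonneg (Nat.cast_nonneg _) hc₁) hVn
  have hr0 : 0 ≤ (D : ℝ) * β := mul_nonneg (Nat.cast_nonneg _) hβ
  -- the order-n term: |S₀| Dⁿ c₁ βⁿ V‖f‖_∞ for n ≥ N, else 0 (as in `lp_walk_bound`)
  have horder : ∀ n : ℕ, Φ (((∑ i, a i) * (∑ i, b i) ^ n) • f) ≤
      if N ≤ n then K * ((D : ℝ) * β) ^ n else 0 := fun n => by
    rw [order_vec_eq_sum_walks adj hab hbb f n]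
    have hterm := walk_term_bound adj hΦ0 hS₀ hS₁a hS₁b hc₁ ha hβ hgr h2 h0 hV h2inf hnrm hgood hsep n
    calc Φ (∑ i, ∑ ys ∈ walks adj i n, (a i * bprod b n ys) • f)
        ≤ ∑ i, Φ (∑ ys ∈ walks adj i n, (a i * bprod b n ys) • f) :=
          Finset.le_sum_of_subadditive Φ hΦ0 hΦadd _ _
      _ ≤ ∑ i, ∑ ys ∈ walks adj i n, Φ ((a i * bprod b n ys) • f) :=
          Finset.sum_le_sum fun i _ => Finset.le_sum_of_subadditive Φ hΦ0 hΦadd _ _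
      _ ≤ ∑ i, ∑ ys ∈ walks adj i n,
            (if i ∈ S₀ then (if N ≤ n then c₁ * β ^ n * (V * nrm 0 f) else 0) else 0) := by
          refine Finset.sum_le_sum fun i _ => Finset.sum_le_sum fun ys hys => ?_
          by_cases hi : i ∈ S₀
          · rw [if_pos hi]; exact hterm i ys (mem_walks.mp hys)
          · rw [if_neg hi, mul_smul]; exact hS₀ i hi _
      _ = ∑ i ∈ S₀, ∑ _ys ∈ walks adj i n, (if N ≤ n then c₁ * β ^ n * (V * nrm 0 f) else 0) := by
          rw [← Finset.sum_subset (Finset.subset_univ S₀) (fun i _ hi => by rw [if_neg hi]; simp)]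
          exact Finset.sum_congr rfl fun i hi => by rw [if_pos hi]
      _ ≤ ∑ _i ∈ S₀, (D : ℝ) ^ n * (if N ≤ n then c₁ * β ^ n * (V * nrm 0 f) else 0) := by
          refine Finset.sum_le_sum fun i _ => ?_
          rw [Finset.sum_const, nsmul_eq_mul]
          refine mul_le_mul_of_nonneg_right (by exact_mod_cast card_walks_le adj hD n i) ?_
          split_ifs
          · exact mul_nonneg (mul_nonneg hc₁ (pow_nonneg hβ n)) hVn
          · exact le_rfl
      _ = if N ≤ n then K * ((D : ℝ) * β) ^ n else 0 := by
          rw [Finset.sum_const, nsmul_eq_mul, hK]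
          split_ifs
          · ring
          · simp
  -- the majorant series: Σ_{n ≥ N} K (Dβ)ⁿ = K (Dβ)^N / (1 − Dβ)
  have hgeo : HasSum (fun n : ℕ => if N ≤ n then K * ((D : ℝ) * β) ^ n else 0)
      (K * ((D : ℝ) * β) ^ N / (1 - D * β)) := by
    have h1 : HasSum (fun m : ℕ => K * ((D : ℝ) * β) ^ N * ((D : ℝ) * β) ^ m)
        (K * ((D : ℝ) * β) ^ N * (1 - (D : ℝ) * β)⁻¹) :=
      (hasSum_geometric_of_lt_one hr0 hDβ).mul_left _
    refine (hasSum_nat_add_iff' N).mp ?_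
    have hz : ∑ i ∈ Finset.range N, (if N ≤ i then K * ((D : ℝ) * β) ^ i else 0) = 0 :=
      Finset.sum_eq_zero fun i hi => by rw [if_neg (not_le.mpr (Finset.mem_range.mp hi))]
    rw [hz, sub_zero, div_eq_mul_inv]
    refine h1.congr_fun fun m => ?_
    show (if N ≤ m + N then K * ((D : ℝ) * β) ^ (m + N) else 0) = K * ((D : ℝ) * β) ^ N * ((D : ℝ) * β) ^ m
    rw [if_pos (Nat.le_add_left N m), pow_add]
    ring
  -- partial sums are bounded by the full majorant
  have hpartial : ∀ m : ℕ, Φ (∑ n ∈ Finset.range m, ((∑ i, a i) * (∑ i, b i) ^ n) • f) ≤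
      K * ((D : ℝ) * β) ^ N / (1 - D * β) := fun m =>
    calc Φ (∑ n ∈ Finset.range m, ((∑ i, a i) * (∑ i, b i) ^ n) • f)
        ≤ ∑ n ∈ Finset.range m, Φ (((∑ i, a i) * (∑ i, b i) ^ n) • f) :=
          Finset.le_sum_of_subadditive Φ hΦ0 hΦadd _ _
      _ ≤ ∑ n ∈ Finset.range m, (if N ≤ n then K * ((D : ℝ) * β) ^ n else 0) :=
          Finset.sum_le_sum fun n _ => horder n
      _ ≤ K * ((D : ℝ) * β) ^ N / (1 - D * β) :=
          sum_le_hasSum _ (fun n _ => by split_ifs <;> [exact mul_nonneg hK0 (pow_nonneg hr0 n); exact le_rfl])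
            hgeo
  -- `G•f = (partial sum)•f + (G R^m)•f` exactly, and the remainder is as small as we please
  refine le_of_forall_pos_le_add fun ε hε => ?_
  obtain ⟨m, hm⟩ := hrem ε hε
  have hsplit : G • f = (∑ n ∈ Finset.range m, ((∑ i, a i) * (∑ i, b i) ^ n) • f)
      + (G * (∑ i, b i) ^ m) • f := by
    rw [← Finset.sum_smul, ← add_smul, ← neumann_partial hG m]
  calc Φ (G • f) ≤ Φ (∑ n ∈ Finset.range m, ((∑ i, a i) * (∑ i, b i) ^ n) • f) + Φ ((G * (∑ i, b i) ^ m) • f) := by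
        rw [hsplit]; exact hΦadd _ _
    _ ≤ K * ((D : ℝ) * β) ^ N / (1 - D * β) + ε := add_le_add (hpartial m) hm
    _ = S₀.card * c₁ * V * ((D : ℝ) * β) ^ N / (1 - D * β) * nrm 0 f + ε := by rw [hK]; ring

/-- **(2.22), EXPONENTIAL FORM** of `lp_walk_bound_rem`: `Dβ ≤ e⁻¹`, `N ≥ r − 2` ⇒ `Φ(G • f) ≤ 2|S₀|c₁Ve²e^{−r}‖f‖_∞`
(`B4LpChain221.tail_222`). [cite: Balaban1983RegularityDecay, (2.22) p.579] -/
theorem lp_walk_bound_rem_exp (adj : ι → ι → Prop) [DecidableRel adj]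
    {a b : ι → R} {G G₀ Rop : R} {f : E} {Φ : E → ℝ} {nrm : ℕ → E → ℝ} {good : ι → Prop}
    {S₀ S₁ : Finset ι} {c₁ β r : ℝ} {D N n₀ : ℕ}
    (hG₀ : G₀ = ∑ i, a i) (hRop : Rop = ∑ i, b i) (hG : G = G₀ + G * Rop)
    (hrem : ∀ ε : ℝ, 0 < ε → ∃ m : ℕ, Φ ((G * Rop ^ m) • f) ≤ ε)
    (hab : ∀ i l, ¬ adj i l → a i * b l = 0) (hbb : ∀ i l, ¬ adj i l → b i * b l = 0)
    (hΦ0 : Φ 0 ≤ 0) (hΦadd : ∀ x y, Φ (x + y) ≤ Φ x + Φ y)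
    (hS₀ : ∀ i ∉ S₀, ∀ g : E, Φ (a i • g) ≤ 0)
    (hS₁a : ∀ i ∉ S₁, a i • f = 0) (hS₁b : ∀ i ∉ S₁, b i • f = 0)
    (hc₁ : 0 ≤ c₁) (ha : ∀ i ∈ S₀, ∀ g : E, Φ (a i • g) ≤ c₁ * nrm 0 g)
    (hβ : 0 ≤ β)
    (hgr : ∀ j, good j → ∀ i, 1 ≤ i → i ≤ n₀ → ∀ g : E, nrm (i - 1) (b j • g) ≤ β * nrm i g)
    (h2 : ∀ (j) (g : E), nrm n₀ (b j • g) ≤ β * nrm n₀ g)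
    (h0 : ∀ j, good j → ∀ g : E, nrm 0 (b j • g) ≤ β * nrm 0 g)
    {V : ℝ} (hV : 1 ≤ V) (h2inf : nrm n₀ f ≤ V * nrm 0 f) (hnrm : 0 ≤ nrm 0 f)
    (hgood : ∀ (n : ℕ) (i : ι), i ∈ S₀ → ∀ ys : Fin n → ι, IsWalk adj i ys →
      ∀ t : Fin n, (t : ℕ) + 1 ≤ n₀ → good (ys t))
    (hD : ∀ j, (Finset.univ.filter fun i => adj j i).card ≤ D) (hDβ : (D : ℝ) * β ≤ Real.exp (-1))
    (hsep : ∀ (n : ℕ) (i : ι), i ∈ S₀ → ∀ ys : Fin n → ι, IsWalk adj i ys → lastPt i n ys ∈ S₁ → N ≤ n)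
    (hN : r - 2 ≤ N) :
    Φ (G • f) ≤ 2 * S₀.card * c₁ * V * Real.exp 2 * Real.exp (-r) * nrm 0 f := by
  have hlt : (D : ℝ) * β < 1 := hDβ.trans_lt (Real.exp_lt_one_iff.mpr (by norm_num))
  have h := lp_walk_bound_rem adj hG₀ hRop hG hrem hab hbb hΦ0 hΦadd hS₀ hS₁a hS₁b hc₁ ha hβ hgr h2 h0 hV h2inf
    hnrm hgood hD hlt hsep
  have ht := tail_222 (mul_nonneg (Nat.cast_nonneg D) hβ) hDβ hN
  have hK : 0 ≤ (S₀.card : ℝ) * c₁ * V := mul_nonneg (mul_nonneg (Nat.cast_nonneg _) hc₁) (zero_le_one.trans hV)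
  calc Φ (G • f) ≤ S₀.card * c₁ * V * ((D : ℝ) * β) ^ N / (1 - D * β) * nrm 0 f := h
    _ = S₀.card * c₁ * V * (((D : ℝ) * β) ^ N / (1 - D * β)) * nrm 0 f := by ring
    _ ≤ S₀.card * c₁ * V * (2 * Real.exp 2 * Real.exp (-r)) * nrm 0 f :=
        mul_le_mul_of_nonneg_right (mul_le_mul_of_nonneg_left ht hK) hnrm
    _ = 2 * S₀.card * c₁ * V * Real.exp 2 * Real.exp (-r) * nrm 0 f := by ring

/-- **(2.18)–(2.22) ON `ℤ^d`, CONVERGENCE FROM THE ESTIMATES**: `lp_walk_bound_rem_exp` for the printed cube adjacency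
(`3^d` successors, injective labels), `R₀` as «labels within `n₀` of `S₀` are good» ((2.19), `good_of_reach`), label
separation `≥ N ≥ r − 2` between `S₀` and `S₁`, and *«3^dc₂O(1)M⁻¹ ≤ e⁻¹»*: `Φ(G • f) ≤ 2|S₀|c₁Ve²e^{−r}‖f‖_∞`.
[cite: Balaban1983RegularityDecay, (2.18)–(2.21) p.578, (2.22) p.579] -/
theorem lattice_lp_walk_bound_rem {d : ℕ} (pos : ι → Fin d → ℤ) (hpos : Function.Injective pos)
    {a b : ι → R} {G G₀ Rop : R} {f : E} {Φ : E → ℝ} {nrm : ℕ → E → ℝ} {good : ι → Prop}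
    {S₀ S₁ : Finset ι} {c₁ β r : ℝ} {N n₀ : ℕ}
    (hG₀ : G₀ = ∑ i, a i) (hRop : Rop = ∑ i, b i) (hG : G = G₀ + G * Rop)
    (hrem : ∀ ε : ℝ, 0 < ε → ∃ m : ℕ, Φ ((G * Rop ^ m) • f) ≤ ε)
    (hab : ∀ i l, ¬ cubeAdj pos i l → a i * b l = 0) (hbb : ∀ i l, ¬ cubeAdj pos i l → b i * b l = 0)
    (hΦ0 : Φ 0 ≤ 0) (hΦadd : ∀ x y, Φ (x + y) ≤ Φ x + Φ y)
    (hS₀ : ∀ i ∉ S₀, ∀ g : E, Φ (a i • g) ≤ 0)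
    (hS₁a : ∀ i ∉ S₁, a i • f = 0) (hS₁b : ∀ i ∉ S₁, b i • f = 0)
    (hc₁ : 0 ≤ c₁) (ha : ∀ i ∈ S₀, ∀ g : E, Φ (a i • g) ≤ c₁ * nrm 0 g)
    (hβ : 0 ≤ β)
    (hgr : ∀ j, good j → ∀ i, 1 ≤ i → i ≤ n₀ → ∀ g : E, nrm (i - 1) (b j • g) ≤ β * nrm i g)
    (h2 : ∀ (j) (g : E), nrm n₀ (b j • g) ≤ β * nrm n₀ g)
    (h0 : ∀ j, good j → ∀ g : E, nrm 0 (b j • g) ≤ β * nrm 0 g)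
    {V : ℝ} (hV : 1 ≤ V) (h2inf : nrm n₀ f ≤ V * nrm 0 f) (hnrm : 0 ≤ nrm 0 f)
    (hR₀ : ∀ i ∈ S₀, ∀ j, (∀ μ, |pos i μ - pos j μ| ≤ n₀) → good j)
    (h3β : (3 : ℝ) ^ d * β ≤ Real.exp (-1))
    (hsep : ∀ i ∈ S₀, ∀ l ∈ S₁, ∃ μ, (N : ℤ) ≤ |pos i μ - pos l μ|) (hN : r - 2 ≤ N) :
    Φ (G • f) ≤ 2 * S₀.card * c₁ * V * Real.exp 2 * Real.exp (-r) * nrm 0 f :=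
  lp_walk_bound_rem_exp (cubeAdj pos) hG₀ hRop hG hrem hab hbb hΦ0 hΦadd hS₀ hS₁a hS₁b hc₁ ha hβ hgr h2 h0 hV
    h2inf hnrm (good_of_reach pos hR₀) (card_cubeAdj_le pos hpos) (D := 3 ^ d) (by exact_mod_cast h3β)
    (le_length_of_separated pos hsep) hN

end Abstract

/-! ## §3. [B4]'s concrete operators: `R` is small in `L²`, the remainder decays, (1.10) for a general `Ω` -/

section Route

variable {X Y κ : Type*} [Fintype X] [Fintype Y] [Fintype κ] [DecidableEq X] [DecidableEq κ] {d : ℕ}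

/-- the labels that can see a site (`h_j(x) ≠ 0`) number at most `2^d`. [cite: Balaban1983RegularityDecay, §2 p.575] -/
private theorem card_labelBox_le (M : ℝ) (x : Fin d → ℝ) :
    (Fintype.piFinset fun μ => ({⌊x μ / M⌋, ⌊x μ / M⌋ + 1} : Finset ℤ)).card ≤ 2 ^ d := by
  rw [Fintype.card_piFinset]
  calc ∏ μ, ({⌊x μ / M⌋, ⌊x μ / M⌋ + 1} : Finset ℤ).card ≤ 2 ^ (Finset.univ : Finset (Fin d)).card :=
        Finset.prod_le_pow_card _ _ 2 fun μ _ => Finset.card_le_two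
    _ = 2 ^ d := by rw [Finset.card_univ, Fintype.card_fin]

/-- the labels whose cube operator has a non-zero row at a site number at most `2^d`. [cite: Balaban1983RegularityDecay, §2 p.575] -/
private theorem card_nearBox_le (M : ℝ) (x : Fin d → ℝ) :
    (Fintype.piFinset fun μ => ({⌊x μ / M + 3 / 4⌋ - 1, ⌊x μ / M + 3 / 4⌋} : Finset ℤ)).card ≤ 2 ^ d := by
  rw [Fintype.card_piFinset]
  calc ∏ μ, ({⌊x μ / M + 3 / 4⌋ - 1, ⌊x μ / M + 3 / 4⌋} : Finset ℤ).card ≤ 2 ^ (Finset.univ : Finset (Fin d)).card :=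
        Finset.prod_le_pow_card _ _ 2 fun μ _ => Finset.card_le_two
    _ = 2 ^ d := by rw [Finset.card_univ, Fintype.card_fin]

/-- `e⁻¹ ≤ 1/2`. [cite: Balaban1983RegularityDecay, (2.22) p.579] -/
private theorem exp_neg_one_le_half : Real.exp (-1) ≤ 1 / 2 := by
  have h := Real.add_one_le_exp (1 : ℝ)
  rw [Real.exp_neg, inv_eq_one_div]
  exact one_div_le_one_div_of_le (by norm_num) (by linarith)

/-- ROW LOCALITY OF `K_l·B` ON VECTORS: `((K_l·B)g)(z,k) = 0` unless `|z − Ml|_∞ < (3/4)M` (data local at scale `M/8`,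
`supp h_l ⊆ {|x − Ml|_∞ < (5/8)M}`; `B4Eq212SmallR.opK_mul_row_eq_zero_of_far`). [cite: Balaban1983RegularityDecay, (2.10)–(2.11) p.576] -/
theorem opK_mul_mulVec_apply_eq_zero_of_far {M : ℝ} (hM : 0 < M) (pos : X → Fin d → ℝ) (l : Fin d → ℤ)
    (c : X → X → ℝ) (m2 a : ℝ) (q : Y → X → ℝ) (W : X → X → Matrix κ κ ℝ) (T : Y → X → Matrix κ κ ℝ)
    (hc : ∀ z z', c z z' ≠ 0 → ∀ μ, |pos z μ - pos z' μ| ≤ 1 / 8 * M)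
    (hq : ∀ y z z', q y z ≠ 0 → q y z' ≠ 0 → ∀ μ, |pos z μ - pos z' μ| ≤ 1 / 8 * M)
    {z : X} (hfar : ¬ ∀ μ, |pos z μ - M * l μ| < 3 / 4 * M) (B : Matrix (X × κ) (X × κ) ℝ) (g : X × κ → ℝ)
    (k : κ) : ((opK c m2 a q W T (fun w => hCube M l (pos w)) * B) *ᵥ g) (z, k) = 0 := by
  simp only [Matrix.mulVec, dotProduct]
  exact Finset.sum_eq_zero fun p _ => by
    rw [opK_mul_row_eq_zero_of_far hM pos l c m2 a q W T hc hq hfar B k p, zero_mul]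

/-- **«R is a small operator in reasonable norms» (p. 577) IN `L²`**: for [B4]'s concrete `R = Σ_j K_jG_k(□_j)h_j`
(2.11), if EVERY summand satisfies the `L²` bound `‖K_jG_jh_jg‖₂ ≤ β‖g‖₂` (Lemma 2.1 (2.15) — available for all cubes,
boundary ones included), then `‖Rg‖₂ ≤ 2^dβ‖g‖₂`: at every site at most `2^d` summands have a non-zero row
(`|z − Mj|_∞ < (3/4)M`) and at most `2^d` read the value there (`supp h_j`), so Cauchy–Schwarz in the label sum costs
`2^d` and the localised inputs `1_{supp h_j}g` overlap at most `2^d` times.  (`η`-weight `w > 0` arbitrary.)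
[cite: Balaban1983RegularityDecay, (2.11)–(2.12) pp.576–577, (2.21) p.578] -/
theorem lpv_two_R_mulVec_le {M : ℝ} (hM : 0 < M) (pos : X → Fin d → ℝ) (c : X → X → ℝ) (m2 a : ℝ)
    (q : Y → X → ℝ)
    (hc : ∀ x z', c x z' ≠ 0 → ∀ μ, |pos x μ - pos z' μ| ≤ 1 / 8 * M)
    (hq : ∀ y x z', q y x ≠ 0 → q y z' ≠ 0 → ∀ μ, |pos x μ - pos z' μ| ≤ 1 / 8 * M)
    (s : Finset (Fin d → ℤ)) (S : (Fin d → ℤ) → X → Prop) [∀ j, DecidablePred (S j)]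
    (W' : (Fin d → ℤ) → X → X → Matrix κ κ ℝ) (T' : (Fin d → ℤ) → Y → X → Matrix κ κ ℝ)
    (Gj : (Fin d → ℤ) → Matrix (X × κ) (X × κ) ℝ) {β w : ℝ} (hβ0 : 0 ≤ β) (hw : 0 < w)
    (h2 : ∀ (i : ↥s) (g : X × κ → ℝ), lpv w 2 ((opK (fun z z' => if (S i.1 z ↔ S i.1 z') then c z z' else 0) m2 a q (W' i.1) (T' i.1)
        (fun z => hCube M i.1 (pos z)) * Gj i.1 * mulH (ι := κ) (fun z => hCube M i.1 (pos z))) *ᵥ g) ≤ β * lpv w 2 g)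
    (g : X × κ → ℝ) :
    lpv w 2 ((∑ j ∈ s, opK (fun z z' => if (S j z ↔ S j z') then c z z' else 0) m2 a q (W' j) (T' j)
        (fun z => hCube M j (pos z)) * Gj j * mulH (ι := κ) (fun z => hCube M j (pos z))) *ᵥ g) ≤ (2 : ℝ) ^ d * β * lpv w 2 g := by
  classical
  set h : (Fin d → ℤ) → X → ℝ := fun j z => hCube M j (pos z) with hh
  set cut : (Fin d → ℤ) → X → X → ℝ := fun j z z' => if (S j z ↔ S j z') then c z z' else 0 with hcut
  set bJ : (Fin d → ℤ) → Matrix (X × κ) (X × κ) ℝ :=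
    fun j => opK (cut j) m2 a q (W' j) (T' j) (h j) * Gj j * mulH (ι := κ) (h j) with hbJ
  -- sums of squares
  set Q : (X × κ → ℝ) → ℝ := fun v => ∑ p, v p ^ 2 with hQ
  have hQnn : ∀ v, 0 ≤ Q v := fun v => Finset.sum_nonneg fun p _ => sq_nonneg _
  have hlpv : ∀ v, lpv w 2 v = Real.sqrt (w * Q v) := fun v => lpv_two_eq_sqrt w v
  -- (i) the `L²` input, squared: `Q(b_j g') ≤ β² Q(g')`
  have hQb : ∀ (j : ↥s) (g' : X × κ → ℝ), Q (bJ j.1 *ᵥ g') ≤ β ^ 2 * Q g' := by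
    intro j g'
    have h1 := h2 j g'
    rw [hlpv, hlpv] at h1
    have h' : w * Q (bJ j.1 *ᵥ g') ≤ (β * Real.sqrt (w * Q g')) ^ 2 := by
      rw [← Real.sq_sqrt (mul_nonneg hw.le (hQnn (bJ j.1 *ᵥ g')))]
      exact pow_le_pow_left₀ (Real.sqrt_nonneg _) h1 2
    rw [mul_pow, Real.sq_sqrt (mul_nonneg hw.le (hQnn g'))] at h'
    have h'' : w * Q (bJ j.1 *ᵥ g') ≤ w * (β ^ 2 * Q g') := h'.trans (le_of_eq (by ring))
    exact le_of_mul_le_mul_left h'' hw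
  -- (ii) input localisation: `b_j g' = b_j (1_{supp h_j} g')`, and the supports overlap at most `2^d` times
  set cutv : (Fin d → ℤ) → (X × κ → ℝ) → (X × κ → ℝ) :=
    fun j g' p => if h j p.1 ≠ 0 then g' p else 0 with hcutv
  have hcutH : ∀ j g', mulH (ι := κ) (h j) *ᵥ g' = mulH (ι := κ) (h j) *ᵥ cutv j g' := by
    intro j g'
    funext p
    rw [mulH_mulVec_apply, mulH_mulVec_apply]
    by_cases hp : h j p.1 ≠ 0
    · simp only [hcutv, if_pos hp]
    · rw [not_not] at hp
      rw [hp, zero_mul, zero_mul]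
  have hcutb : ∀ j g', bJ j *ᵥ g' = bJ j *ᵥ cutv j g' := by
    intro j g'
    simp only [hbJ]
    rw [← Matrix.mulVec_mulVec, hcutH j g', Matrix.mulVec_mulVec]
  have hQcut : ∑ j ∈ s, Q (cutv j g) ≤ 2 ^ d * Q g := by
    have hcardp : ∀ p : X × κ, ((s.filter fun j => h j p.1 ≠ 0).card : ℝ) ≤ 2 ^ d := by
      intro p
      have hsub : (s.filter fun j => h j p.1 ≠ 0)
          ⊆ Fintype.piFinset fun μ => ({⌊pos p.1 μ / M⌋, ⌊pos p.1 μ / M⌋ + 1} : Finset ℤ) := by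
        intro j hj
        exact mem_box_of_hCube_ne_zero (Finset.mem_filter.mp hj).2
      exact_mod_cast (Finset.card_le_card hsub).trans (card_labelBox_le M (pos p.1))
    calc ∑ j ∈ s, Q (cutv j g) = ∑ j ∈ s, ∑ p, (if h j p.1 ≠ 0 then g p ^ 2 else 0) := by
          refine Finset.sum_congr rfl fun j _ => Finset.sum_congr rfl fun p _ => ?_
          by_cases hp : h j p.1 ≠ 0
          · simp only [hcutv, if_pos hp]
          · simp only [hcutv, if_neg hp]
            ring
      _ = ∑ p, ∑ j ∈ s, (if h j p.1 ≠ 0 then g p ^ 2 else 0) := Finset.sum_comm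
      _ = ∑ p, ((s.filter fun j => h j p.1 ≠ 0).card : ℝ) * g p ^ 2 := by
          refine Finset.sum_congr rfl fun p _ => ?_
          rw [← Finset.sum_filter, Finset.sum_const, nsmul_eq_mul]
      _ ≤ ∑ p, (2 : ℝ) ^ d * g p ^ 2 :=
          Finset.sum_le_sum fun p _ => mul_le_mul_of_nonneg_right (hcardp p) (sq_nonneg _)
      _ = 2 ^ d * Q g := by rw [← Finset.mul_sum]
  -- (iii) output localisation: the row `(z,k)` of `b_l` vanishes unless `l` is one of the `≤ 2^d` labels near `z`
  have hM8 : 1 / 8 * M ≤ 3 / 4 * M := by nlinarith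
  have hcut_loc : ∀ l z z', cut l z z' ≠ 0 → ∀ μ, |pos z μ - pos z' μ| ≤ 1 / 8 * M :=
    fun l z z' hne μ => cut_local pos c (S l) hc z z' hne μ
  have hrow : ∀ (p : X × κ) (l : Fin d → ℤ),
      l ∉ (Fintype.piFinset fun μ => ({⌊pos p.1 μ / M + 3 / 4⌋ - 1, ⌊pos p.1 μ / M + 3 / 4⌋} : Finset ℤ)) →
      (bJ l *ᵥ g) p = 0 := by
    rintro ⟨z, k⟩ l hln
    have hfar : ¬ ∀ μ, |pos z μ - M * l μ| < 3 / 4 * M := fun hn => hln (mem_nearBox_of_near hM hn)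
    simp only [hbJ]
    rw [Matrix.mul_assoc]
    exact opK_mul_mulVec_apply_eq_zero_of_far hM pos l (cut l) m2 a q (W' l) (T' l) (hcut_loc l) hq hfar _ g k
  have hQR : Q ((∑ j ∈ s, bJ j) *ᵥ g) ≤ 2 ^ d * ∑ j ∈ s, Q (bJ j *ᵥ g) := by
    calc Q ((∑ j ∈ s, bJ j) *ᵥ g) = ∑ p, (∑ j ∈ s, (bJ j *ᵥ g) p) ^ 2 := by
          simp only [hQ, Matrix.sum_mulVec, Finset.sum_apply]
      _ = ∑ p : X × κ, (∑ j ∈ s.filter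
            (· ∈ Fintype.piFinset fun μ => ({⌊pos p.1 μ / M + 3 / 4⌋ - 1, ⌊pos p.1 μ / M + 3 / 4⌋} : Finset ℤ)),
            (bJ j *ᵥ g) p) ^ 2 := by
          refine Finset.sum_congr rfl fun p _ => ?_
          congr 1
          rw [Finset.sum_filter_of_ne]
          intro j _ hne
          by_contra hjn
          exact hne (hrow p j hjn)
      _ ≤ ∑ p : X × κ, (((s.filter
            (· ∈ Fintype.piFinset fun μ => ({⌊pos p.1 μ / M + 3 / 4⌋ - 1, ⌊pos p.1 μ / M + 3 / 4⌋} : Finset ℤ))).card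
              : ℝ) * ∑ j ∈ s.filter
            (· ∈ Fintype.piFinset fun μ => ({⌊pos p.1 μ / M + 3 / 4⌋ - 1, ⌊pos p.1 μ / M + 3 / 4⌋} : Finset ℤ)),
            (bJ j *ᵥ g) p ^ 2) :=
          Finset.sum_le_sum fun p _ => sq_sum_le_card_mul_sum_sq
      _ ≤ ∑ p : X × κ, ((2 : ℝ) ^ d * ∑ j ∈ s, (bJ j *ᵥ g) p ^ 2) := by
          refine Finset.sum_le_sum fun p _ => ?_
          refine mul_le_mul ?_ ?_ (Finset.sum_nonneg fun j _ => sq_nonneg _) (by positivity)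
          · have hsub : s.filter (· ∈ Fintype.piFinset fun μ =>
                ({⌊pos p.1 μ / M + 3 / 4⌋ - 1, ⌊pos p.1 μ / M + 3 / 4⌋} : Finset ℤ))
                ⊆ Fintype.piFinset fun μ => ({⌊pos p.1 μ / M + 3 / 4⌋ - 1, ⌊pos p.1 μ / M + 3 / 4⌋} : Finset ℤ) :=
              fun j hj => (Finset.mem_filter.mp hj).2
            exact_mod_cast (Finset.card_le_card hsub).trans (card_nearBox_le M (pos p.1))
          · exact Finset.sum_le_sum_of_subset_of_nonneg (Finset.filter_subset _ _) fun j _ _ => sq_nonneg _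
      _ = 2 ^ d * ∑ j ∈ s, Q (bJ j *ᵥ g) := by
          rw [← Finset.mul_sum, Finset.sum_comm]
  -- (iv) assemble and take square roots
  have hQtot : Q ((∑ j ∈ s, bJ j) *ᵥ g) ≤ ((2 : ℝ) ^ d * β) ^ 2 * Q g := by
    calc Q ((∑ j ∈ s, bJ j) *ᵥ g) ≤ 2 ^ d * ∑ j ∈ s, Q (bJ j *ᵥ g) := hQR
      _ = 2 ^ d * ∑ j ∈ s, Q (bJ j *ᵥ cutv j g) :=
          congrArg _ (Finset.sum_congr rfl fun j _ => by rw [hcutb j g])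
      _ ≤ 2 ^ d * ∑ j ∈ s, β ^ 2 * Q (cutv j g) :=
          mul_le_mul_of_nonneg_left (Finset.sum_le_sum fun j hj => hQb ⟨j, hj⟩ _) (by positivity)
      _ = 2 ^ d * β ^ 2 * ∑ j ∈ s, Q (cutv j g) := by rw [← Finset.mul_sum]; ring
      _ ≤ 2 ^ d * β ^ 2 * (2 ^ d * Q g) := mul_le_mul_of_nonneg_left hQcut (by positivity)
      _ = ((2 : ℝ) ^ d * β) ^ 2 * Q g := by ring
  rw [hlpv, hlpv]
  calc Real.sqrt (w * Q ((∑ j ∈ s, bJ j) *ᵥ g)) ≤ Real.sqrt (w * (((2 : ℝ) ^ d * β) ^ 2 * Q g)) :=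
        Real.sqrt_le_sqrt (mul_le_mul_of_nonneg_left hQtot hw.le)
    _ = Real.sqrt (((2 : ℝ) ^ d * β) ^ 2 * (w * Q g)) := by rw [mul_left_comm]
    _ = (2 : ℝ) ^ d * β * Real.sqrt (w * Q g) := by
        rw [Real.sqrt_mul (sq_nonneg _), Real.sqrt_sq (by positivity)]

/-- hence `‖R^m f‖₂ ≤ (2^dβ)^m‖f‖₂` — the `L²` content of *«R is a small operator»*, which makes the remainder of the
walk expansion (2.18) tend to zero. [cite: Balaban1983RegularityDecay, (2.12) p.577, (2.18) p.578] -/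
theorem lpv_two_R_pow_mulVec_le {M : ℝ} (hM : 0 < M) (pos : X → Fin d → ℝ) (c : X → X → ℝ) (m2 a : ℝ)
    (q : Y → X → ℝ)
    (hc : ∀ x z', c x z' ≠ 0 → ∀ μ, |pos x μ - pos z' μ| ≤ 1 / 8 * M)
    (hq : ∀ y x z', q y x ≠ 0 → q y z' ≠ 0 → ∀ μ, |pos x μ - pos z' μ| ≤ 1 / 8 * M)
    (s : Finset (Fin d → ℤ)) (S : (Fin d → ℤ) → X → Prop) [∀ j, DecidablePred (S j)]
    (W' : (Fin d → ℤ) → X → X → Matrix κ κ ℝ) (T' : (Fin d → ℤ) → Y → X → Matrix κ κ ℝ)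
    (Gj : (Fin d → ℤ) → Matrix (X × κ) (X × κ) ℝ) {β w : ℝ} (hβ0 : 0 ≤ β) (hw : 0 < w)
    (h2 : ∀ (i : ↥s) (g : X × κ → ℝ), lpv w 2 ((opK (fun z z' => if (S i.1 z ↔ S i.1 z') then c z z' else 0) m2 a q (W' i.1) (T' i.1)
        (fun z => hCube M i.1 (pos z)) * Gj i.1 * mulH (ι := κ) (fun z => hCube M i.1 (pos z))) *ᵥ g) ≤ β * lpv w 2 g)
    (f : X × κ → ℝ) (m : ℕ) :
    lpv w 2 (((∑ j ∈ s, opK (fun z z' => if (S j z ↔ S j z') then c z z' else 0) m2 a q (W' j) (T' j)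
        (fun z => hCube M j (pos z)) * Gj j * mulH (ι := κ) (fun z => hCube M j (pos z))) ^ m) *ᵥ f) ≤ ((2 : ℝ) ^ d * β) ^ m * lpv w 2 f := by
  induction m with
  | zero => rw [pow_zero, Matrix.one_mulVec, pow_zero, one_mul]
  | succ m ih =>
      rw [pow_succ', ← Matrix.mulVec_mulVec, pow_succ']
      calc lpv w 2 ((∑ j ∈ s, opK (fun z z' => if (S j z ↔ S j z') then c z z' else 0) m2 a q (W' j) (T' j)
        (fun z => hCube M j (pos z)) * Gj j * mulH (ι := κ) (fun z => hCube M j (pos z))) *ᵥ (((∑ j ∈ s, opK (fun z z' => if (S j z ↔ S j z') then c z z' else 0) m2 a q (W' j) (T' j)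
        (fun z => hCube M j (pos z)) * Gj j * mulH (ι := κ) (fun z => hCube M j (pos z))) ^ m) *ᵥ f))
          ≤ (2 : ℝ) ^ d * β * lpv w 2 (((∑ j ∈ s, opK (fun z z' => if (S j z ↔ S j z') then c z z' else 0) m2 a q (W' j) (T' j)
        (fun z => hCube M j (pos z)) * Gj j * mulH (ι := κ) (fun z => hCube M j (pos z))) ^ m) *ᵥ f) :=
            lpv_two_R_mulVec_le hM pos c m2 a q hc hq s S W' T' Gj hβ0 hw h2 _
        _ ≤ (2 : ℝ) ^ d * β * (((2 : ℝ) ^ d * β) ^ m * lpv w 2 f) := mul_le_mul_of_nonneg_left ih (by positivity)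
        _ = (2 : ℝ) ^ d * β * ((2 : ℝ) ^ d * β) ^ m * lpv w 2 f := by ring

/-- **[B4] THEOREM (1.10), VALUE MEMBER, GENERAL `Ω`, UNDER `dist(x, Ω^c) ≥ R₀` — BY THE PRINTED MIXED `L^p` CHAIN
(2.18)–(2.22) ON THE CONCRETE OPERATORS.**  Setting of `B4Ineq110WalkRoute.ineq110_value`: sites `X` (of `Ω`) with
positions `pos`, `H = −Δ_W + m² + aQ^*Q = covOp c m² a q W T` (1.6) local at scale `M/8` with inverse `G = G_k(Ω,A)`
(`G·H = 1`), labels `s ⊇ {j : h_j ≠ 0 on X}`, cube sets `S_j ⊇ (7/8)M`-cubes, cube data `W′_j, T′_j` (↦ `Ã_j`) agreeing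
with `W, T` on the `(3/4)M`-plateau, cube operators `H_j` (Neumann cut at `∂S_j`) with `H_jG_j = 1`; letters
`a_j = h_jG_jh_j` (2.2), `b_j = K_jG_jh_j` (2.11).  INPUTS, in exactly the printed norms (vectors `X × κ → ℝ`; level `0`
= `‖·‖_∞`, level `i` = `η`-weighted `ℓ^{2n₀/i}`, level `n₀` = `ℓ²`; `w = η^d > 0`, `n₀ ≥ 1`): a predicate `good` on labels
(*«□_{ω_i} are cubes contained in Ω»*) such that at GOOD cubes `‖G_j‖ ≤ γ` (the first letter, (2.16)/(2.17) at
`p = q = ∞`), `‖K_jG_jh_j‖_{∞→∞} ≤ β` ((2.20)) and `‖K_jG_jh_jg‖_{(i−1)} ≤ β‖g‖_{(i)}` for `1 ≤ i ≤ n₀` ((2.21), Lemma 2.2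
with `1/p − 1/q = 1/p₁`, `p₁ = 2n₀`); at ALL cubes `‖K_jG_jh_jg‖₂ ≤ β‖g‖₂` ((2.21), Lemma 2.1 (2.15)); `3^dβ ≤ e⁻¹`
(*«M is fixed such that 3^dc₂O(1)M⁻¹ ≤ e⁻¹»*); the `R₀` CONDITION IN LABEL FORM ((2.19)): every label of `s` within
sup-distance `n₀` of a cube seeing `x` is good.  CONCLUSION: for every `f` supported in `F × κ` with `‖f‖₂ ≤ V‖f‖_∞`
(`V ≥ 1`; `lpv_two_le`) and every `D ≤ dist_∞(x, F)`:
`‖1_x ⊙ (G_k(Ω,A)f)‖_∞ ≤ 2^{d+1}e^{9/4}·γ·V·e^{−D/M}·‖f‖_∞`.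
DISCHARGED INSIDE (no analytic input): `H·G₀ = 1 − R` hence `G = G₀ + GR` (`B4Eq26Locality.parametrix_identity_hCube`);
locality `a_ib_l = 0 = b_ib_l` for `|i − l|_∞ > 1` (`B4Eq213Locality`); `‖Rg‖₂ ≤ 2^dβ‖g‖₂` (`lpv_two_R_mulVec_le`) and
the decay of the remainder `‖1_x ⊙ (GR^mf)‖_∞ ≤ ‖G‖(2^dβ)^m‖f‖₂/√w → 0` — the convergence of (2.18) *«as one of the
consequences of our estimates»*; at most `2^d` starting cubes; label separation `⌊D/M − 5/4⌋ ≥ (D/M − 1/4) − 2`.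
[cite: Balaban1983RegularityDecay, Theorem (1.10) p.573; (2.12)–(2.13) p.577; (2.18)–(2.21) p.578; (2.22) p.579] -/
theorem ineq110_value_lp {M : ℝ} (hM : 0 < M) (pos : X → Fin d → ℝ) (c : X → X → ℝ) (m2 a : ℝ)
    (q : Y → X → ℝ) (W : X → X → Matrix κ κ ℝ) (T : Y → X → Matrix κ κ ℝ)
    (hc : ∀ x z', c x z' ≠ 0 → ∀ μ, |pos x μ - pos z' μ| ≤ 1 / 8 * M)
    (hq : ∀ y x z', q y x ≠ 0 → q y z' ≠ 0 → ∀ μ, |pos x μ - pos z' μ| ≤ 1 / 8 * M)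
    (s : Finset (Fin d → ℤ)) (hs : ∀ j x, hCube M j (pos x) ≠ 0 → j ∈ s)
    (S : (Fin d → ℤ) → X → Prop) [∀ j, DecidablePred (S j)]
    (hS : ∀ j z, (∀ μ, |pos z μ - M * j μ| ≤ 7 / 8 * M) → S j z)
    (W' : (Fin d → ℤ) → X → X → Matrix κ κ ℝ) (T' : (Fin d → ℤ) → Y → X → Matrix κ κ ℝ)
    (hWW' : ∀ j x z', (∀ μ, |pos x μ - M * j μ| ≤ 3 / 4 * M) → (∀ μ, |pos z' μ - M * j μ| ≤ 3 / 4 * M) →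
      W' j x z' = W x z')
    (hTT' : ∀ j y x, q y x ≠ 0 → (∀ μ, |pos x μ - M * j μ| ≤ 3 / 4 * M) → T' j y x = T y x)
    (Gj : (Fin d → ℤ) → Matrix (X × κ) (X × κ) ℝ)
    (hGj : ∀ j ∈ s, covOp (fun z z' => if (S j z ↔ S j z') then c z z' else 0) m2 a q (W' j) (T' j) * Gj j = 1)
    (G : Matrix (X × κ) (X × κ) ℝ) (hGH : G * covOp c m2 a q W T = 1)
    -- the interior cubes and the per-cube analytic inputs, in the printed norms
    (good : (Fin d → ℤ) → Prop) {γ β w : ℝ} {n₀ : ℕ} (hn₀ : 0 < n₀) (hw : 0 < w) (hγ0 : 0 ≤ γ) (hβ0 : 0 ≤ β)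
    (hγ : ∀ i : ↥s, good i.1 → ‖Gj i.1‖ ≤ γ)
    (h0 : ∀ i : ↥s, good i.1 → ‖opK (fun z z' => if (S i.1 z ↔ S i.1 z') then c z z' else 0) m2 a q (W' i.1) (T' i.1)
        (fun z => hCube M i.1 (pos z)) * Gj i.1 * mulH (ι := κ) (fun z => hCube M i.1 (pos z))‖ ≤ β)
    (hgr : ∀ i : ↥s, good i.1 → ∀ t : ℕ, 1 ≤ t → t ≤ n₀ → ∀ g : X × κ → ℝ,
      lvl w n₀ (t - 1) ((opK (fun z z' => if (S i.1 z ↔ S i.1 z') then c z z' else 0) m2 a q (W' i.1) (T' i.1)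
        (fun z => hCube M i.1 (pos z)) * Gj i.1 * mulH (ι := κ) (fun z => hCube M i.1 (pos z))) *ᵥ g) ≤ β * lvl w n₀ t g)
    (h2 : ∀ (i : ↥s) (g : X × κ → ℝ), lpv w 2 ((opK (fun z z' => if (S i.1 z ↔ S i.1 z') then c z z' else 0) m2 a q (W' i.1) (T' i.1)
        (fun z => hCube M i.1 (pos z)) * Gj i.1 * mulH (ι := κ) (fun z => hCube M i.1 (pos z))) *ᵥ g) ≤ β * lpv w 2 g)
    (h3β : (3 : ℝ) ^ d * β ≤ Real.exp (-1))
    -- the site with its `R₀` condition in label form, the support set, their separation, the function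
    (x : X) (hR₀ : ∀ i ∈ s, hCube M i (pos x) ≠ 0 → ∀ j ∈ s, (∀ μ, |i μ - j μ| ≤ (n₀ : ℤ)) → good j)
    (F : X → Prop) [DecidablePred F] {D : ℝ} (hD : ∀ x', F x' → ∃ μ, D ≤ |pos x μ - pos x' μ|)
    (f : X × κ → ℝ) (hfF : ∀ p : X × κ, ¬ F p.1 → f p = 0) {V : ℝ} (hV : 1 ≤ V) (hfV : lpv w 2 f ≤ V * ‖f‖) :
    ‖mulH (ι := κ) (fun z => if z = x then (1 : ℝ) else 0) *ᵥ (G *ᵥ f)‖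
      ≤ 2 ^ (d + 1) * Real.exp (9 / 4) * γ * V * Real.exp (-(D / M)) * ‖f‖ := by
  classical
  -- the letters
  set h : (Fin d → ℤ) → X → ℝ := fun j z => hCube M j (pos z) with hh
  set cut : (Fin d → ℤ) → X → X → ℝ := fun j z z' => if (S j z ↔ S j z') then c z z' else 0 with hcut
  set aJ : (Fin d → ℤ) → Matrix (X × κ) (X × κ) ℝ :=
    fun j => mulH (ι := κ) (h j) * Gj j * mulH (ι := κ) (h j) with haJ
  set bJ : (Fin d → ℤ) → Matrix (X × κ) (X × κ) ℝ :=
    fun j => opK (cut j) m2 a q (W' j) (T' j) (h j) * Gj j * mulH (ι := κ) (h j) with hbJ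
  set P : Matrix (X × κ) (X × κ) ℝ := mulH (ι := κ) (fun z => if z = x then (1 : ℝ) else 0) with hPdef
  have hV0 : 0 ≤ V := zero_le_one.trans hV
  -- sizes of the letters
  have hh1 : ∀ j z, |h j z| ≤ 1 := fun j z =>
    abs_le.mpr ⟨by linarith [hCube_nonneg M j (pos z)], hCube_le_one M j (pos z)⟩
  have hnH : ∀ j, ‖mulH (ι := κ) (h j)‖ ≤ 1 := fun j => norm_mulH_le _ zero_le_one (hh1 j)
  have hnP : ‖P‖ ≤ 1 := norm_mulH_le _ zero_le_one fun z => by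
    by_cases hz : z = x <;> simp [hz]
  -- (2.9)–(2.12): `H·G₀ = 1 − R`, hence `G = G₀ + G·R`
  have h211 : covOp c m2 a q W T * ∑ j ∈ s, aJ j = 1 - ∑ j ∈ s, bJ j :=
    parametrix_identity_hCube hM pos c m2 a q W T s hs S hS hc hq W' T' hWW' hTT' Gj hGj
  have hGeq : G * (1 - ∑ j ∈ s, bJ j) = ∑ j ∈ s, aJ j := G_mul_one_sub_eq hGH h211
  have hG' : G = ∑ j ∈ s, aJ j + G * ∑ j ∈ s, bJ j := by
    rw [← hGeq, mul_sub, mul_one]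
    abel
  -- locality of the cube data at scale `(3/4)M`: `a_ib_l = 0 = b_ib_l` unless `|i − l|_∞ ≤ 1`
  have hM8 : 1 / 8 * M ≤ 3 / 4 * M := by nlinarith
  have hcut_loc : ∀ l z z', cut l z z' ≠ 0 → ∀ μ, |pos z μ - pos z' μ| ≤ 3 / 4 * M :=
    fun l z z' hne μ => (cut_local pos c (S l) hc z z' hne μ).trans hM8
  have hq_loc : ∀ y z z', q y z ≠ 0 → q y z' ≠ 0 → ∀ μ, |pos z μ - pos z' μ| ≤ 3 / 4 * M :=
    fun y z z' h1 h2 μ => (hq y z z' h1 h2 μ).trans hM8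
  have hloc : ∀ i l : ↥s, ¬ cubeAdj (fun i : ↥s => i.1) i l →
      mulH (ι := κ) (h i.1) * opK (cut l.1) m2 a q (W' l.1) (T' l.1) (h l.1) = 0 :=
    fun i l hil => mulH_hCube_mul_opK_eq_zero hM pos (cut l.1) m2 a q (W' l.1) (T' l.1) (hcut_loc l.1) hq_loc hil
  have hab : ∀ i l : ↥s, ¬ cubeAdj (fun i : ↥s => i.1) i l → aJ i.1 * bJ l.1 = 0 := by
    intro i l hil
    simp only [haJ, hbJ]
    rw [show mulH (ι := κ) (h i.1) * Gj i.1 * mulH (ι := κ) (h i.1)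
          * (opK (cut l.1) m2 a q (W' l.1) (T' l.1) (h l.1) * Gj l.1 * mulH (ι := κ) (h l.1))
        = mulH (ι := κ) (h i.1) * Gj i.1
          * (mulH (ι := κ) (h i.1) * opK (cut l.1) m2 a q (W' l.1) (T' l.1) (h l.1))
          * Gj l.1 * mulH (ι := κ) (h l.1) by simp only [Matrix.mul_assoc],
      hloc i l hil, Matrix.mul_zero, Matrix.zero_mul, Matrix.zero_mul]
  have hbb : ∀ i l : ↥s, ¬ cubeAdj (fun i : ↥s => i.1) i l → bJ i.1 * bJ l.1 = 0 := by
    intro i l hil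
    simp only [hbJ]
    rw [show opK (cut i.1) m2 a q (W' i.1) (T' i.1) (h i.1) * Gj i.1 * mulH (ι := κ) (h i.1)
          * (opK (cut l.1) m2 a q (W' l.1) (T' l.1) (h l.1) * Gj l.1 * mulH (ι := κ) (h l.1))
        = opK (cut i.1) m2 a q (W' i.1) (T' i.1) (h i.1) * Gj i.1
          * (mulH (ι := κ) (h i.1) * opK (cut l.1) m2 a q (W' l.1) (T' l.1) (h l.1))
          * Gj l.1 * mulH (ι := κ) (h l.1) by simp only [Matrix.mul_assoc],
      hloc i l hil, Matrix.mul_zero, Matrix.zero_mul, Matrix.zero_mul]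
  -- the starting cubes (seeing `x`) and the final cubes (seeing `F`)
  set S₀ : Finset ↥s := Finset.univ.filter fun i : ↥s => h i.1 x ≠ 0 with hS₀
  set S₁ : Finset ↥s := Finset.univ.filter fun i : ↥s => ∃ x', F x' ∧ h i.1 x' ≠ 0 with hS₁
  have hP : ∀ i : ↥s, i ∉ S₀ → P * aJ i.1 = 0 := by
    intro i hi
    have hix : h i.1 x = 0 := by
      by_contra hne
      exact hi (Finset.mem_filter.mpr ⟨Finset.mem_univ _, hne⟩)
    have hzero : P * mulH (ι := κ) (h i.1) = 0 := by
      rw [hPdef, mulH_mul_mulH]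
      refine mulH_eq_zero_of fun z => ?_
      by_cases hz : z = x
      · rw [hz, hix, mul_zero]
      · rw [if_neg hz, zero_mul]
    simp only [haJ]
    rw [← Matrix.mul_assoc, ← Matrix.mul_assoc, hzero, Matrix.zero_mul, Matrix.zero_mul]
  have hF0 : ∀ i : ↥s, i ∉ S₁ → mulH (ι := κ) (h i.1) *ᵥ f = 0 := by
    intro i hi
    funext p
    rw [mulH_mulVec_apply, Pi.zero_apply]
    by_cases hz : F p.1
    · have hiz : h i.1 p.1 = 0 := by
        by_contra hne
        exact hi (Finset.mem_filter.mpr ⟨Finset.mem_univ _, p.1, hz, hne⟩)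
      rw [hiz, zero_mul]
    · rw [hfF p hz, mul_zero]
  have hS₁a : ∀ i : ↥s, i ∉ S₁ → aJ i.1 • f = 0 := by
    intro i hi
    rw [Matrix.smul_eq_mulVec]
    simp only [haJ]
    rw [← Matrix.mulVec_mulVec, hF0 i hi, Matrix.mulVec_zero]
  have hS₁b : ∀ i : ↥s, i ∉ S₁ → bJ i.1 • f = 0 := by
    intro i hi
    rw [Matrix.smul_eq_mulVec]
    simp only [hbJ]
    rw [← Matrix.mulVec_mulVec, hF0 i hi, Matrix.mulVec_zero]
  -- the probe functional `Φ(g) = ‖1_x ⊙ g‖_∞`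
  have hS₀' : ∀ i : ↥s, i ∉ S₀ → ∀ g : X × κ → ℝ, ‖P *ᵥ (aJ i.1 • g)‖ ≤ 0 := by
    intro i hi g
    rw [Matrix.smul_eq_mulVec, Matrix.mulVec_mulVec, hP i hi, Matrix.zero_mulVec, norm_zero]
  have hgoodS₀ : ∀ i ∈ S₀, good i.1 := fun i hi =>
    hR₀ i.1 i.2 (Finset.mem_filter.mp hi).2 i.1 i.2 fun μ => by simp
  have hnA : ∀ i ∈ S₀, ‖aJ i.1‖ ≤ γ := by
    intro i hi
    calc ‖aJ i.1‖ ≤ ‖mulH (ι := κ) (h i.1) * Gj i.1‖ * ‖mulH (ι := κ) (h i.1)‖ := norm_mul_le _ _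
      _ ≤ (‖mulH (ι := κ) (h i.1)‖ * ‖Gj i.1‖) * ‖mulH (ι := κ) (h i.1)‖ :=
          mul_le_mul_of_nonneg_right (norm_mul_le _ _) (norm_nonneg _)
      _ ≤ (1 * γ) * 1 :=
          mul_le_mul (mul_le_mul (hnH i.1) (hγ i (hgoodS₀ i hi)) (norm_nonneg _) zero_le_one) (hnH i.1)
            (norm_nonneg _) (by rw [one_mul]; exact hγ0)
      _ = γ := by ring
  have ha' : ∀ i ∈ S₀, ∀ g : X × κ → ℝ, ‖P *ᵥ (aJ i.1 • g)‖ ≤ γ * lvl w n₀ 0 g := by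
    intro i hi g
    rw [Matrix.smul_eq_mulVec, Matrix.mulVec_mulVec, lvl_zero]
    calc ‖(P * aJ i.1) *ᵥ g‖ ≤ ‖P * aJ i.1‖ * ‖g‖ := Matrix.linfty_opNorm_mulVec _ _
      _ ≤ γ * ‖g‖ := by
          refine mul_le_mul_of_nonneg_right ((norm_mul_le _ _).trans ?_) (norm_nonneg _)
          calc ‖P‖ * ‖aJ i.1‖ ≤ 1 * γ := mul_le_mul hnP (hnA i hi) (norm_nonneg _) zero_le_one
            _ = γ := one_mul γ
  -- the per-cube inputs in the abstract chain's format
  have hgr' : ∀ j : ↥s, good j.1 → ∀ t : ℕ, 1 ≤ t → t ≤ n₀ → ∀ g : X × κ → ℝ,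
      lvl w n₀ (t - 1) (bJ j.1 • g) ≤ β * lvl w n₀ t g := fun j hj t ht1 ht2 g => by
    rw [Matrix.smul_eq_mulVec]
    exact hgr j hj t ht1 ht2 g
  have h2' : ∀ (j : ↥s) (g : X × κ → ℝ), lvl w n₀ n₀ (bJ j.1 • g) ≤ β * lvl w n₀ n₀ g := fun j g => by
    rw [Matrix.smul_eq_mulVec, lvl_top w hn₀, lvl_top w hn₀]
    exact h2 j g
  have h0' : ∀ j : ↥s, good j.1 → ∀ g : X × κ → ℝ, lvl w n₀ 0 (bJ j.1 • g) ≤ β * lvl w n₀ 0 g :=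
    fun j hj g => by
    rw [Matrix.smul_eq_mulVec, lvl_zero, lvl_zero]
    exact (Matrix.linfty_opNorm_mulVec _ _).trans (mul_le_mul_of_nonneg_right (h0 j hj) (norm_nonneg _))
  have h2inf' : lvl w n₀ n₀ f ≤ V * lvl w n₀ 0 f := by
    rw [lvl_top w hn₀, lvl_zero]
    exact hfV
  have hR₀' : ∀ i ∈ S₀, ∀ j : ↥s, (∀ μ, |i.1 μ - j.1 μ| ≤ (n₀ : ℤ)) → good j.1 :=
    fun i hi j hij => hR₀ i.1 i.2 (Finset.mem_filter.mp hi).2 j.1 j.2 hij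
  -- the separation of the labels: `N = ⌊D/M − 5/4⌋ ≥ (D/M − 1/4) − 2`
  set N : ℕ := ⌊D / M - 5 / 4⌋₊ with hNdef
  have hN : (D / M - 1 / 4) - 2 ≤ (N : ℝ) := by
    have := Nat.sub_one_lt_floor (D / M - 5 / 4)
    linarith
  have hsep : ∀ i ∈ S₀, ∀ l ∈ S₁, ∃ μ, (N : ℤ) ≤ |i.1 μ - l.1 μ| := by
    intro i hi l hl
    obtain ⟨-, hix⟩ := Finset.mem_filter.mp hi
    obtain ⟨-, x', hFx', hlx'⟩ := Finset.mem_filter.mp hl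
    obtain ⟨μ, hμ⟩ := hD x' hFx'
    refine ⟨μ, ?_⟩
    by_cases hDM : 0 ≤ D / M - 5 / 4
    · have hNle : (N : ℝ) ≤ D / M - 5 / 4 := Nat.floor_le hDM
      have hND : ((N : ℝ) + 5 / 4) * M ≤ D := by
        have : (N : ℝ) + 5 / 4 ≤ D / M := by linarith
        rwa [le_div_iff₀ hM] at this
      have h1 : |pos x μ - M * i.1 μ| < 5 / 8 * M := hCube_ne_zero_imp hM hix μ
      have h2 : |pos x' μ - M * l.1 μ| < 5 / 8 * M := hCube_ne_zero_imp hM hlx' μ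
      have h3 : ((N : ℝ) + 5 / 4) * M ≤ |pos x μ - pos x' μ| := hND.trans hμ
      have htri : |pos x μ - pos x' μ|
          ≤ |pos x μ - M * i.1 μ| + |M * i.1 μ - M * l.1 μ| + |pos x' μ - M * l.1 μ| := by
        calc |pos x μ - pos x' μ|
            = |(pos x μ - M * i.1 μ) + (M * i.1 μ - M * l.1 μ) + (M * l.1 μ - pos x' μ)| := by ring_nf
          _ ≤ |pos x μ - M * i.1 μ| + |M * i.1 μ - M * l.1 μ| + |M * l.1 μ - pos x' μ| := abs_add_three _ _ _
          _ = _ := by rw [abs_sub_comm (M * l.1 μ) (pos x' μ)]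
      have h4 : (N : ℝ) * M < |M * i.1 μ - M * l.1 μ| := by linarith
      rw [← mul_sub, abs_mul, abs_of_pos hM] at h4
      have h5 : (N : ℝ) < |((i.1 μ : ℤ) : ℝ) - l.1 μ| := lt_of_mul_lt_mul_right (by linarith) hM.le
      have h6 : ((N : ℤ) : ℝ) < (|i.1 μ - l.1 μ| : ℤ) := by push_cast; exact h5
      exact (Int.cast_lt.mp h6).le
    · have hN0 : N = 0 := Nat.floor_eq_zero.mpr (by linarith)
      rw [hN0]
      simp
  have hcardS₀ : S₀.card ≤ 2 ^ d := by
    have hsub : S₀.map (Function.Embedding.subtype (· ∈ s))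
        ⊆ Fintype.piFinset fun μ => ({⌊pos x μ / M⌋, ⌊pos x μ / M⌋ + 1} : Finset ℤ) := by
      intro j hj
      obtain ⟨i, hi, rfl⟩ := Finset.mem_map.mp hj
      obtain ⟨-, hix⟩ := Finset.mem_filter.mp hi
      exact mem_box_of_hCube_ne_zero hix
    calc S₀.card = (S₀.map (Function.Embedding.subtype (· ∈ s))).card := (Finset.card_map _).symm
      _ ≤ _ := Finset.card_le_card hsub
      _ ≤ 2 ^ d := card_labelBox_le M (pos x)
  -- THE REMAINDER DECAYS: `‖1_x ⊙ (G R^m f)‖_∞ ≤ ‖G‖(2^dβ)^m‖f‖₂/√w`, and `2^dβ ≤ 3^dβ ≤ e⁻¹ ≤ 1/2`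
  have hθ : (2 : ℝ) ^ d * β ≤ 1 / 2 :=
    ((mul_le_mul_of_nonneg_right (pow_le_pow_left₀ (by norm_num) (by norm_num) d) hβ0).trans h3β).trans
      exp_neg_one_le_half
  have hrem : ∀ ε : ℝ, 0 < ε → ∃ m : ℕ, ‖P *ᵥ ((G * (∑ j ∈ s, bJ j) ^ m) • f)‖ ≤ ε := by
    intro ε hε
    set C : ℝ := ‖G‖ * (lpv w 2 f / Real.sqrt w) with hC
    have hC0 : 0 ≤ C := mul_nonneg (norm_nonneg _) (div_nonneg (lpv_nonneg hw.le 2 f) (Real.sqrt_nonneg _))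
    obtain ⟨m, hm⟩ := exists_pow_lt_of_lt_one (show 0 < ε / (C + 1) by positivity) (show (1 / 2 : ℝ) < 1 by norm_num)
    refine ⟨m, ?_⟩
    rw [Matrix.smul_eq_mulVec, ← Matrix.mulVec_mulVec, Matrix.mulVec_mulVec]
    have hPG : ‖P * G‖ ≤ ‖G‖ :=
      (norm_mul_le _ _).trans ((mul_le_mul_of_nonneg_right hnP (norm_nonneg _)).trans (le_of_eq (one_mul _)))
    rw [lt_div_iff₀ (by positivity)] at hm
    calc ‖(P * G) *ᵥ (((∑ j ∈ s, bJ j) ^ m) *ᵥ f)‖ ≤ ‖P * G‖ * ‖((∑ j ∈ s, bJ j) ^ m) *ᵥ f‖ :=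
          Matrix.linfty_opNorm_mulVec _ _
      _ ≤ ‖G‖ * (lpv w 2 (((∑ j ∈ s, bJ j) ^ m) *ᵥ f) / Real.sqrt w) :=
          mul_le_mul hPG (norm_le_lpv_two hw _) (norm_nonneg _) (norm_nonneg _)
      _ ≤ ‖G‖ * ((((2 : ℝ) ^ d * β) ^ m * lpv w 2 f) / Real.sqrt w) := by
          gcongr
          exact lpv_two_R_pow_mulVec_le hM pos c m2 a q hc hq s S W' T' Gj hβ0 hw h2 f m
      _ = ((2 : ℝ) ^ d * β) ^ m * C := by rw [hC]; ring
      _ ≤ (1 / 2 : ℝ) ^ m * C := mul_le_mul_of_nonneg_right (pow_le_pow_left₀ (by positivity) hθ m) hC0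
      _ ≤ (1 / 2 : ℝ) ^ m * (C + 1) := by gcongr; linarith
      _ ≤ ε := hm.le
  -- the abstract chain (2.18)–(2.22), convergence from the estimates
  have hmain := lattice_lp_walk_bound_rem (R := Matrix (X × κ) (X × κ) ℝ) (E := X × κ → ℝ)
    (fun i : ↥s => i.1) Subtype.val_injective
    (a := fun i : ↥s => aJ i.1) (b := fun i : ↥s => bJ i.1) (G := G) (f := f)
    (Φ := fun g => ‖P *ᵥ g‖) (nrm := lvl w n₀) (good := fun i : ↥s => good i.1)
    (S₀ := S₀) (S₁ := S₁) (c₁ := γ) (β := β) (r := D / M - 1 / 4) (N := N) (n₀ := n₀) (V := V)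
    (by rw [Finset.sum_coe_sort s aJ]) (by rw [Finset.sum_coe_sort s bJ]) hG' hrem hab hbb
    (by simp) (fun u v => by simpa [Matrix.mulVec_add] using norm_add_le (P *ᵥ u) (P *ᵥ v))
    hS₀' hS₁a hS₁b hγ0 ha' hβ0 hgr' h2' h0' hV h2inf' (by rw [lvl_zero]; exact norm_nonneg _) hR₀' h3β hsep hN
  simp only [Matrix.smul_eq_mulVec, lvl_zero] at hmain
  -- the exponent bookkeeping
  have hexp : Real.exp 2 * Real.exp (-(D / M - 1 / 4)) = Real.exp (9 / 4) * Real.exp (-(D / M)) := by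
    rw [← Real.exp_add, ← Real.exp_add]
    congr 1
    ring
  calc ‖P *ᵥ (G *ᵥ f)‖ ≤ 2 * S₀.card * γ * V * Real.exp 2 * Real.exp (-(D / M - 1 / 4)) * ‖f‖ := hmain
    _ ≤ 2 * (2 : ℝ) ^ d * γ * V * Real.exp 2 * Real.exp (-(D / M - 1 / 4)) * ‖f‖ := by
        gcongr
        exact_mod_cast hcardS₀
    _ = 2 * (2 : ℝ) ^ d * γ * V * (Real.exp 2 * Real.exp (-(D / M - 1 / 4))) * ‖f‖ := by ring
    _ = 2 ^ (d + 1) * Real.exp (9 / 4) * γ * V * Real.exp (-(D / M)) * ‖f‖ := by rw [hexp]; ring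

/-- **(1.10) AS PRINTED, value member, general `Ω` under the `R₀` condition**: for `f` supported in `F × κ` with
`‖f‖₂ ≤ V‖f‖_∞`, every colour `k` and every `D ≤ dist_∞(x,F)`:
`|(G_k(Ω,A)f)(x)_k| ≤ 2^{d+1}e^{9/4}γV·e^{−D/M}·‖f‖_∞` — *«|(G_k(Ω,A)f)(x)| ≤ c₀exp(−δ₀dist(x,supp f))‖f‖_∞ (1.10) for
x ∈ Ω, dist(x,Ω^c) ≥ R₀»* with `c₀ = 2^{d+1}e^{9/4}γV`, `δ₀ = M⁻¹`. [cite: Balaban1983RegularityDecay, Theorem (1.10) p.573] -/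
theorem ineq110_value_lp_apply {M : ℝ} (hM : 0 < M) (pos : X → Fin d → ℝ) (c : X → X → ℝ) (m2 a : ℝ)
    (q : Y → X → ℝ) (W : X → X → Matrix κ κ ℝ) (T : Y → X → Matrix κ κ ℝ)
    (hc : ∀ x z', c x z' ≠ 0 → ∀ μ, |pos x μ - pos z' μ| ≤ 1 / 8 * M)
    (hq : ∀ y x z', q y x ≠ 0 → q y z' ≠ 0 → ∀ μ, |pos x μ - pos z' μ| ≤ 1 / 8 * M)
    (s : Finset (Fin d → ℤ)) (hs : ∀ j x, hCube M j (pos x) ≠ 0 → j ∈ s)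
    (S : (Fin d → ℤ) → X → Prop) [∀ j, DecidablePred (S j)]
    (hS : ∀ j z, (∀ μ, |pos z μ - M * j μ| ≤ 7 / 8 * M) → S j z)
    (W' : (Fin d → ℤ) → X → X → Matrix κ κ ℝ) (T' : (Fin d → ℤ) → Y → X → Matrix κ κ ℝ)
    (hWW' : ∀ j x z', (∀ μ, |pos x μ - M * j μ| ≤ 3 / 4 * M) → (∀ μ, |pos z' μ - M * j μ| ≤ 3 / 4 * M) →
      W' j x z' = W x z')
    (hTT' : ∀ j y x, q y x ≠ 0 → (∀ μ, |pos x μ - M * j μ| ≤ 3 / 4 * M) → T' j y x = T y x)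
    (Gj : (Fin d → ℤ) → Matrix (X × κ) (X × κ) ℝ)
    (hGj : ∀ j ∈ s, covOp (fun z z' => if (S j z ↔ S j z') then c z z' else 0) m2 a q (W' j) (T' j) * Gj j = 1)
    (G : Matrix (X × κ) (X × κ) ℝ) (hGH : G * covOp c m2 a q W T = 1)
    (good : (Fin d → ℤ) → Prop) {γ β w : ℝ} {n₀ : ℕ} (hn₀ : 0 < n₀) (hw : 0 < w) (hγ0 : 0 ≤ γ) (hβ0 : 0 ≤ β)
    (hγ : ∀ i : ↥s, good i.1 → ‖Gj i.1‖ ≤ γ)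
    (h0 : ∀ i : ↥s, good i.1 → ‖opK (fun z z' => if (S i.1 z ↔ S i.1 z') then c z z' else 0) m2 a q (W' i.1) (T' i.1)
        (fun z => hCube M i.1 (pos z)) * Gj i.1 * mulH (ι := κ) (fun z => hCube M i.1 (pos z))‖ ≤ β)
    (hgr : ∀ i : ↥s, good i.1 → ∀ t : ℕ, 1 ≤ t → t ≤ n₀ → ∀ g : X × κ → ℝ,
      lvl w n₀ (t - 1) ((opK (fun z z' => if (S i.1 z ↔ S i.1 z') then c z z' else 0) m2 a q (W' i.1) (T' i.1)
        (fun z => hCube M i.1 (pos z)) * Gj i.1 * mulH (ι := κ) (fun z => hCube M i.1 (pos z))) *ᵥ g) ≤ β * lvl w n₀ t g)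
    (h2 : ∀ (i : ↥s) (g : X × κ → ℝ), lpv w 2 ((opK (fun z z' => if (S i.1 z ↔ S i.1 z') then c z z' else 0) m2 a q (W' i.1) (T' i.1)
        (fun z => hCube M i.1 (pos z)) * Gj i.1 * mulH (ι := κ) (fun z => hCube M i.1 (pos z))) *ᵥ g) ≤ β * lpv w 2 g)
    (h3β : (3 : ℝ) ^ d * β ≤ Real.exp (-1))
    (x : X) (hR₀ : ∀ i ∈ s, hCube M i (pos x) ≠ 0 → ∀ j ∈ s, (∀ μ, |i μ - j μ| ≤ (n₀ : ℤ)) → good j)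
    (F : X → Prop) [DecidablePred F] {D : ℝ} (hD : ∀ x', F x' → ∃ μ, D ≤ |pos x μ - pos x' μ|)
    (f : X × κ → ℝ) (hfF : ∀ p : X × κ, ¬ F p.1 → f p = 0) {V : ℝ} (hV : 1 ≤ V) (hfV : lpv w 2 f ≤ V * ‖f‖)
    (k : κ) :
    |(G *ᵥ f) (x, k)| ≤ 2 ^ (d + 1) * Real.exp (9 / 4) * γ * V * Real.exp (-(D / M)) * ‖f‖ := by
  have h := ineq110_value_lp hM pos c m2 a q W T hc hq s hs S hS W' T' hWW' hTT' Gj hGj G hGH good hn₀ hw hγ0 hβ0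
    hγ h0 hgr h2 h3β x hR₀ F hD f hfF hV hfV
  have hentry : (mulH (ι := κ) (fun z => if z = x then (1 : ℝ) else 0) *ᵥ (G *ᵥ f)) (x, k) = (G *ᵥ f) (x, k) := by
    rw [mulH_mulVec_apply, if_pos rfl, one_mul]
  rw [← hentry, ← Real.norm_eq_abs]
  exact (norm_le_pi_norm _ (x, k)).trans h

/-! ## §4. The chain for an arbitrary local probe (first letter `c₁` = the probe input) -/

/-- **THE MIXED `L^p` CHAIN FOR AN ARBITRARY LOCAL PROBE, GENERAL `Ω`, `R₀` IN LABEL FORM.**  Concrete data as in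
`ineq110_value_lp`.  A PROBE is any matrix `P` with `P·h_j = 0` for the labels `j` outside a set `S₀` of at most `m₀`
cubes, all with `|x₀ − Mj|_∞ < ρM`, carrying the first-letter input `‖P·h_jG_jh_j‖_{∞→∞} ≤ α_P` for `j ∈ S₀` (print:
the constant `c₁` of (2.18)/(2.20)/(2.21), from (2.16)/(2.17) at the interior cubes seeing `x, x′`); the factor inputs
are those of `ineq110_value_lp` (sup and graded bounds at good cubes, `L²` at all cubes, `3^dβ ≤ e⁻¹`), and the `R₀`
condition asks that the labels within `n₀` of `S₀` be good.  Then for `f` supported in `F × κ`, `‖f‖₂ ≤ V‖f‖_∞`,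
`D ≤ dist_∞(x₀, F)`:  `‖P(G_k(Ω,A)f)‖_∞ ≤ 2m₀α_P·V·e^{ρ+13/8}·e^{−D/M}·‖f‖_∞` (label separation `⌊D/M − ρ − 5/8⌋`,
tail (2.22); the remainder of (2.18) decays by `lpv_two_R_pow_mulVec_le`).  The value, derivative and Hölder members
of (1.9)/(1.10) are the probes `1_x`, `E_{xy}[U(A_{xy})] − E_{xx}[1]`, `σ(E_{xx′}[U(A(Γ))] − E_{xx}[1])`.
[cite: Balaban1983RegularityDecay, (2.13) p.577, (2.18)–(2.21) p.578, (2.22) p.579, Theorem p.573] -/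
theorem probe_bound_lp {M : ℝ} (hM : 0 < M) (pos : X → Fin d → ℝ) (c : X → X → ℝ) (m2 a : ℝ)
    (q : Y → X → ℝ) (W : X → X → Matrix κ κ ℝ) (T : Y → X → Matrix κ κ ℝ)
    (hc : ∀ x z', c x z' ≠ 0 → ∀ μ, |pos x μ - pos z' μ| ≤ 1 / 8 * M)
    (hq : ∀ y x z', q y x ≠ 0 → q y z' ≠ 0 → ∀ μ, |pos x μ - pos z' μ| ≤ 1 / 8 * M)
    (s : Finset (Fin d → ℤ)) (hs : ∀ j x, hCube M j (pos x) ≠ 0 → j ∈ s)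
    (S : (Fin d → ℤ) → X → Prop) [∀ j, DecidablePred (S j)]
    (hS : ∀ j z, (∀ μ, |pos z μ - M * j μ| ≤ 7 / 8 * M) → S j z)
    (W' : (Fin d → ℤ) → X → X → Matrix κ κ ℝ) (T' : (Fin d → ℤ) → Y → X → Matrix κ κ ℝ)
    (hWW' : ∀ j x z', (∀ μ, |pos x μ - M * j μ| ≤ 3 / 4 * M) → (∀ μ, |pos z' μ - M * j μ| ≤ 3 / 4 * M) →
      W' j x z' = W x z')
    (hTT' : ∀ j y x, q y x ≠ 0 → (∀ μ, |pos x μ - M * j μ| ≤ 3 / 4 * M) → T' j y x = T y x)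
    (Gj : (Fin d → ℤ) → Matrix (X × κ) (X × κ) ℝ)
    (hGj : ∀ j ∈ s, covOp (fun z z' => if (S j z ↔ S j z') then c z z' else 0) m2 a q (W' j) (T' j) * Gj j = 1)
    (G : Matrix (X × κ) (X × κ) ℝ) (hGH : G * covOp c m2 a q W T = 1)
    -- the probe
    (P : Matrix (X × κ) (X × κ) ℝ) (S₀ : Finset ↥s) {m₀ : ℕ} (hcard : S₀.card ≤ m₀)
    (hP0 : ∀ i : ↥s, i ∉ S₀ → P * mulH (ι := κ) (fun z => hCube M i.1 (pos z)) = 0)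
    (x₀ : X) {ρ : ℝ} (hS₀ρ : ∀ i ∈ S₀, ∀ μ, |pos x₀ μ - M * i.1 μ| < ρ * M)
    -- the interior cubes and the per-cube analytic inputs, in the printed norms
    (good : (Fin d → ℤ) → Prop) {αP β w : ℝ} {n₀ : ℕ} (hn₀ : 0 < n₀) (hw : 0 < w) (hαP0 : 0 ≤ αP) (hβ0 : 0 ≤ β)
    (hαP : ∀ i ∈ S₀, ‖P * (mulH (ι := κ) (fun z => hCube M i.1 (pos z)) * Gj i.1
        * mulH (ι := κ) (fun z => hCube M i.1 (pos z)))‖ ≤ αP)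
    (h0 : ∀ i : ↥s, good i.1 → ‖opK (fun z z' => if (S i.1 z ↔ S i.1 z') then c z z' else 0) m2 a q (W' i.1) (T' i.1)
        (fun z => hCube M i.1 (pos z)) * Gj i.1 * mulH (ι := κ) (fun z => hCube M i.1 (pos z))‖ ≤ β)
    (hgr : ∀ i : ↥s, good i.1 → ∀ t : ℕ, 1 ≤ t → t ≤ n₀ → ∀ g : X × κ → ℝ,
      lvl w n₀ (t - 1) ((opK (fun z z' => if (S i.1 z ↔ S i.1 z') then c z z' else 0) m2 a q (W' i.1) (T' i.1)
        (fun z => hCube M i.1 (pos z)) * Gj i.1 * mulH (ι := κ) (fun z => hCube M i.1 (pos z))) *ᵥ g) ≤ β * lvl w n₀ t g)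
    (h2 : ∀ (i : ↥s) (g : X × κ → ℝ), lpv w 2 ((opK (fun z z' => if (S i.1 z ↔ S i.1 z') then c z z' else 0) m2 a q (W' i.1) (T' i.1)
        (fun z => hCube M i.1 (pos z)) * Gj i.1 * mulH (ι := κ) (fun z => hCube M i.1 (pos z))) *ᵥ g) ≤ β * lpv w 2 g)
    (h3β : (3 : ℝ) ^ d * β ≤ Real.exp (-1))
    (hR₀ : ∀ i ∈ S₀, ∀ j : ↥s, (∀ μ, |i.1 μ - j.1 μ| ≤ (n₀ : ℤ)) → good j.1)
    -- the support set, its separation from `x₀`, the function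
    (F : X → Prop) [DecidablePred F] {D : ℝ} (hD : ∀ x', F x' → ∃ μ, D ≤ |pos x₀ μ - pos x' μ|)
    (f : X × κ → ℝ) (hfF : ∀ p : X × κ, ¬ F p.1 → f p = 0) {V : ℝ} (hV : 1 ≤ V) (hfV : lpv w 2 f ≤ V * ‖f‖) :
    ‖P *ᵥ (G *ᵥ f)‖ ≤ 2 * m₀ * αP * V * Real.exp (ρ + 13 / 8) * Real.exp (-(D / M)) * ‖f‖ := by
  classical
  -- the letters
  set h : (Fin d → ℤ) → X → ℝ := fun j z => hCube M j (pos z) with hh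
  set cut : (Fin d → ℤ) → X → X → ℝ := fun j z z' => if (S j z ↔ S j z') then c z z' else 0 with hcut
  set aJ : (Fin d → ℤ) → Matrix (X × κ) (X × κ) ℝ :=
    fun j => mulH (ι := κ) (h j) * Gj j * mulH (ι := κ) (h j) with haJ
  set bJ : (Fin d → ℤ) → Matrix (X × κ) (X × κ) ℝ :=
    fun j => opK (cut j) m2 a q (W' j) (T' j) (h j) * Gj j * mulH (ι := κ) (h j) with hbJ
  have hV0 : 0 ≤ V := zero_le_one.trans hV
  -- (2.9)–(2.12): `H·G₀ = 1 − R`, hence `G = G₀ + G·R`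
  have h211 : covOp c m2 a q W T * ∑ j ∈ s, aJ j = 1 - ∑ j ∈ s, bJ j :=
    parametrix_identity_hCube hM pos c m2 a q W T s hs S hS hc hq W' T' hWW' hTT' Gj hGj
  have hGeq : G * (1 - ∑ j ∈ s, bJ j) = ∑ j ∈ s, aJ j := G_mul_one_sub_eq hGH h211
  have hG' : G = ∑ j ∈ s, aJ j + G * ∑ j ∈ s, bJ j := by
    rw [← hGeq, mul_sub, mul_one]
    abel
  -- locality of the cube data at scale `(3/4)M`
  have hM8 : 1 / 8 * M ≤ 3 / 4 * M := by nlinarith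
  have hcut_loc : ∀ l z z', cut l z z' ≠ 0 → ∀ μ, |pos z μ - pos z' μ| ≤ 3 / 4 * M :=
    fun l z z' hne μ => (cut_local pos c (S l) hc z z' hne μ).trans hM8
  have hq_loc : ∀ y z z', q y z ≠ 0 → q y z' ≠ 0 → ∀ μ, |pos z μ - pos z' μ| ≤ 3 / 4 * M :=
    fun y z z' h1 h2 μ => (hq y z z' h1 h2 μ).trans hM8
  have hloc : ∀ i l : ↥s, ¬ cubeAdj (fun i : ↥s => i.1) i l →
      mulH (ι := κ) (h i.1) * opK (cut l.1) m2 a q (W' l.1) (T' l.1) (h l.1) = 0 :=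
    fun i l hil => mulH_hCube_mul_opK_eq_zero hM pos (cut l.1) m2 a q (W' l.1) (T' l.1) (hcut_loc l.1) hq_loc hil
  have hab : ∀ i l : ↥s, ¬ cubeAdj (fun i : ↥s => i.1) i l → aJ i.1 * bJ l.1 = 0 := by
    intro i l hil
    simp only [haJ, hbJ]
    rw [show mulH (ι := κ) (h i.1) * Gj i.1 * mulH (ι := κ) (h i.1)
          * (opK (cut l.1) m2 a q (W' l.1) (T' l.1) (h l.1) * Gj l.1 * mulH (ι := κ) (h l.1))
        = mulH (ι := κ) (h i.1) * Gj i.1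
          * (mulH (ι := κ) (h i.1) * opK (cut l.1) m2 a q (W' l.1) (T' l.1) (h l.1))
          * Gj l.1 * mulH (ι := κ) (h l.1) by simp only [Matrix.mul_assoc],
      hloc i l hil, Matrix.mul_zero, Matrix.zero_mul, Matrix.zero_mul]
  have hbb : ∀ i l : ↥s, ¬ cubeAdj (fun i : ↥s => i.1) i l → bJ i.1 * bJ l.1 = 0 := by
    intro i l hil
    simp only [hbJ]
    rw [show opK (cut i.1) m2 a q (W' i.1) (T' i.1) (h i.1) * Gj i.1 * mulH (ι := κ) (h i.1)
          * (opK (cut l.1) m2 a q (W' l.1) (T' l.1) (h l.1) * Gj l.1 * mulH (ι := κ) (h l.1))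
        = opK (cut i.1) m2 a q (W' i.1) (T' i.1) (h i.1) * Gj i.1
          * (mulH (ι := κ) (h i.1) * opK (cut l.1) m2 a q (W' l.1) (T' l.1) (h l.1))
          * Gj l.1 * mulH (ι := κ) (h l.1) by simp only [Matrix.mul_assoc],
      hloc i l hil, Matrix.mul_zero, Matrix.zero_mul, Matrix.zero_mul]
  -- the final cubes (seeing `F`); the probe sees only `S₀`
  set S₁ : Finset ↥s := Finset.univ.filter fun i : ↥s => ∃ x', F x' ∧ h i.1 x' ≠ 0 with hS₁
  have hPa0 : ∀ i : ↥s, i ∉ S₀ → P * aJ i.1 = 0 := by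
    intro i hi
    simp only [haJ]
    rw [← Matrix.mul_assoc, ← Matrix.mul_assoc, hP0 i hi, Matrix.zero_mul, Matrix.zero_mul]
  have hF0 : ∀ i : ↥s, i ∉ S₁ → mulH (ι := κ) (h i.1) *ᵥ f = 0 := by
    intro i hi
    funext p
    rw [mulH_mulVec_apply, Pi.zero_apply]
    by_cases hz : F p.1
    · have hiz : h i.1 p.1 = 0 := by
        by_contra hne
        exact hi (Finset.mem_filter.mpr ⟨Finset.mem_univ _, p.1, hz, hne⟩)
      rw [hiz, zero_mul]
    · rw [hfF p hz, mul_zero]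
  have hS₁a : ∀ i : ↥s, i ∉ S₁ → aJ i.1 • f = 0 := by
    intro i hi
    rw [Matrix.smul_eq_mulVec]
    simp only [haJ]
    rw [← Matrix.mulVec_mulVec, hF0 i hi, Matrix.mulVec_zero]
  have hS₁b : ∀ i : ↥s, i ∉ S₁ → bJ i.1 • f = 0 := by
    intro i hi
    rw [Matrix.smul_eq_mulVec]
    simp only [hbJ]
    rw [← Matrix.mulVec_mulVec, hF0 i hi, Matrix.mulVec_zero]
  -- the probe functional `Φ(g) = ‖P g‖_∞`
  have hS₀' : ∀ i : ↥s, i ∉ S₀ → ∀ g : X × κ → ℝ, ‖P *ᵥ (aJ i.1 • g)‖ ≤ 0 := by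
    intro i hi g
    rw [Matrix.smul_eq_mulVec, Matrix.mulVec_mulVec, hPa0 i hi, Matrix.zero_mulVec, norm_zero]
  have ha' : ∀ i ∈ S₀, ∀ g : X × κ → ℝ, ‖P *ᵥ (aJ i.1 • g)‖ ≤ αP * lvl w n₀ 0 g := by
    intro i hi g
    rw [Matrix.smul_eq_mulVec, Matrix.mulVec_mulVec, lvl_zero]
    exact (Matrix.linfty_opNorm_mulVec _ _).trans (mul_le_mul_of_nonneg_right (hαP i hi) (norm_nonneg _))
  -- the per-cube inputs in the abstract chain's format
  have hgr' : ∀ j : ↥s, good j.1 → ∀ t : ℕ, 1 ≤ t → t ≤ n₀ → ∀ g : X × κ → ℝ,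
      lvl w n₀ (t - 1) (bJ j.1 • g) ≤ β * lvl w n₀ t g := fun j hj t ht1 ht2 g => by
    rw [Matrix.smul_eq_mulVec]
    exact hgr j hj t ht1 ht2 g
  have h2' : ∀ (j : ↥s) (g : X × κ → ℝ), lvl w n₀ n₀ (bJ j.1 • g) ≤ β * lvl w n₀ n₀ g := fun j g => by
    rw [Matrix.smul_eq_mulVec, lvl_top w hn₀, lvl_top w hn₀]
    exact h2 j g
  have h0' : ∀ j : ↥s, good j.1 → ∀ g : X × κ → ℝ, lvl w n₀ 0 (bJ j.1 • g) ≤ β * lvl w n₀ 0 g :=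
    fun j hj g => by
    rw [Matrix.smul_eq_mulVec, lvl_zero, lvl_zero]
    exact (Matrix.linfty_opNorm_mulVec _ _).trans (mul_le_mul_of_nonneg_right (h0 j hj) (norm_nonneg _))
  have h2inf' : lvl w n₀ n₀ f ≤ V * lvl w n₀ 0 f := by
    rw [lvl_top w hn₀, lvl_zero]
    exact hfV
  -- the separation of the labels: `N = ⌊D/M − ρ − 5/8⌋ ≥ (D/M − ρ + 3/8) − 2`
  set N : ℕ := ⌊D / M - ρ - 5 / 8⌋₊ with hNdef
  have hN : (D / M - ρ + 3 / 8) - 2 ≤ (N : ℝ) := by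
    have := Nat.sub_one_lt_floor (D / M - ρ - 5 / 8)
    linarith
  have hsep : ∀ i ∈ S₀, ∀ l ∈ S₁, ∃ μ, (N : ℤ) ≤ |i.1 μ - l.1 μ| := by
    intro i hi l hl
    obtain ⟨-, x', hFx', hlx'⟩ := Finset.mem_filter.mp hl
    obtain ⟨μ, hμ⟩ := hD x' hFx'
    refine ⟨μ, ?_⟩
    by_cases hDM : 0 ≤ D / M - ρ - 5 / 8
    · have hNle : (N : ℝ) ≤ D / M - ρ - 5 / 8 := Nat.floor_le hDM
      have hND : ((N : ℝ) + ρ + 5 / 8) * M ≤ D := by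
        have : (N : ℝ) + ρ + 5 / 8 ≤ D / M := by linarith
        rwa [le_div_iff₀ hM] at this
      have h1 : |pos x₀ μ - M * i.1 μ| < ρ * M := hS₀ρ i hi μ
      have h2 : |pos x' μ - M * l.1 μ| < 5 / 8 * M := hCube_ne_zero_imp hM hlx' μ
      have h3 : ((N : ℝ) + ρ + 5 / 8) * M ≤ |pos x₀ μ - pos x' μ| := hND.trans hμ
      have htri : |pos x₀ μ - pos x' μ|
          ≤ |pos x₀ μ - M * i.1 μ| + |M * i.1 μ - M * l.1 μ| + |pos x' μ - M * l.1 μ| := by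
        calc |pos x₀ μ - pos x' μ|
            = |(pos x₀ μ - M * i.1 μ) + (M * i.1 μ - M * l.1 μ) + (M * l.1 μ - pos x' μ)| := by ring_nf
          _ ≤ |pos x₀ μ - M * i.1 μ| + |M * i.1 μ - M * l.1 μ| + |M * l.1 μ - pos x' μ| := abs_add_three _ _ _
          _ = _ := by rw [abs_sub_comm (M * l.1 μ) (pos x' μ)]
      have h4 : (N : ℝ) * M < |M * i.1 μ - M * l.1 μ| := by nlinarith
      rw [← mul_sub, abs_mul, abs_of_pos hM] at h4
      have h5 : (N : ℝ) < |((i.1 μ : ℤ) : ℝ) - l.1 μ| := lt_of_mul_lt_mul_right (by linarith) hM.le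
      have h6 : ((N : ℤ) : ℝ) < (|i.1 μ - l.1 μ| : ℤ) := by push_cast; exact h5
      exact (Int.cast_lt.mp h6).le
    · have hN0 : N = 0 := Nat.floor_eq_zero.mpr (by linarith)
      rw [hN0]
      simp
  -- THE REMAINDER DECAYS: `‖P(G R^m f)‖_∞ ≤ ‖P‖‖G‖(2^dβ)^m‖f‖₂/√w`, `2^dβ ≤ 1/2`
  have hθ : (2 : ℝ) ^ d * β ≤ 1 / 2 :=
    ((mul_le_mul_of_nonneg_right (pow_le_pow_left₀ (by norm_num) (by norm_num) d) hβ0).trans h3β).trans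
      exp_neg_one_le_half
  have hrem : ∀ ε : ℝ, 0 < ε → ∃ m : ℕ, ‖P *ᵥ ((G * (∑ j ∈ s, bJ j) ^ m) • f)‖ ≤ ε := by
    intro ε hε
    set C : ℝ := ‖P * G‖ * (lpv w 2 f / Real.sqrt w) with hC
    have hC0 : 0 ≤ C := mul_nonneg (norm_nonneg _) (div_nonneg (lpv_nonneg hw.le 2 f) (Real.sqrt_nonneg _))
    obtain ⟨m, hm⟩ := exists_pow_lt_of_lt_one (show 0 < ε / (C + 1) by positivity) (show (1 / 2 : ℝ) < 1 by norm_num)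
    refine ⟨m, ?_⟩
    rw [Matrix.smul_eq_mulVec, ← Matrix.mulVec_mulVec, Matrix.mulVec_mulVec]
    rw [lt_div_iff₀ (by positivity)] at hm
    calc ‖(P * G) *ᵥ (((∑ j ∈ s, bJ j) ^ m) *ᵥ f)‖ ≤ ‖P * G‖ * ‖((∑ j ∈ s, bJ j) ^ m) *ᵥ f‖ :=
          Matrix.linfty_opNorm_mulVec _ _
      _ ≤ ‖P * G‖ * (lpv w 2 (((∑ j ∈ s, bJ j) ^ m) *ᵥ f) / Real.sqrt w) :=
          mul_le_mul_of_nonneg_left (norm_le_lpv_two hw _) (norm_nonneg _)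
      _ ≤ ‖P * G‖ * ((((2 : ℝ) ^ d * β) ^ m * lpv w 2 f) / Real.sqrt w) := by
          gcongr
          exact lpv_two_R_pow_mulVec_le hM pos c m2 a q hc hq s S W' T' Gj hβ0 hw h2 f m
      _ = ((2 : ℝ) ^ d * β) ^ m * C := by rw [hC]; ring
      _ ≤ (1 / 2 : ℝ) ^ m * C := mul_le_mul_of_nonneg_right (pow_le_pow_left₀ (by positivity) hθ m) hC0
      _ ≤ (1 / 2 : ℝ) ^ m * (C + 1) := by gcongr; linarith
      _ ≤ ε := hm.le
  -- the abstract chain (2.18)–(2.22), convergence from the estimates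
  have hmain := lattice_lp_walk_bound_rem (R := Matrix (X × κ) (X × κ) ℝ) (E := X × κ → ℝ)
    (fun i : ↥s => i.1) Subtype.val_injective
    (a := fun i : ↥s => aJ i.1) (b := fun i : ↥s => bJ i.1) (G := G) (f := f)
    (Φ := fun g => ‖P *ᵥ g‖) (nrm := lvl w n₀) (good := fun i : ↥s => good i.1)
    (S₀ := S₀) (S₁ := S₁) (c₁ := αP) (β := β) (r := D / M - ρ + 3 / 8) (N := N) (n₀ := n₀) (V := V)
    (by rw [Finset.sum_coe_sort s aJ]) (by rw [Finset.sum_coe_sort s bJ]) hG' hrem hab hbb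
    (by simp) (fun u v => by simpa [Matrix.mulVec_add] using norm_add_le (P *ᵥ u) (P *ᵥ v))
    hS₀' hS₁a hS₁b hαP0 ha' hβ0 hgr' h2' h0' hV h2inf' (by rw [lvl_zero]; exact norm_nonneg _) hR₀ h3β hsep hN
  simp only [Matrix.smul_eq_mulVec, lvl_zero] at hmain
  -- the exponent bookkeeping
  have hexp : Real.exp 2 * Real.exp (-(D / M - ρ + 3 / 8)) = Real.exp (ρ + 13 / 8) * Real.exp (-(D / M)) := by
    rw [← Real.exp_add, ← Real.exp_add]
    congr 1
    ring
  calc ‖P *ᵥ (G *ᵥ f)‖ ≤ 2 * S₀.card * αP * V * Real.exp 2 * Real.exp (-(D / M - ρ + 3 / 8)) * ‖f‖ := hmain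
    _ ≤ 2 * (m₀ : ℝ) * αP * V * Real.exp 2 * Real.exp (-(D / M - ρ + 3 / 8)) * ‖f‖ := by
        gcongr
    _ = 2 * (m₀ : ℝ) * αP * V * (Real.exp 2 * Real.exp (-(D / M - ρ + 3 / 8))) * ‖f‖ := by ring
    _ = 2 * m₀ * αP * V * Real.exp (ρ + 13 / 8) * Real.exp (-(D / M)) * ‖f‖ := by rw [hexp]; ring

end Route

end Literature.MathematicalPhysics.QuantumFieldTheory.Balaban1983to89.B4Ineq110LpChain
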